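import Mathlib
import Literature.NumberTheory.Transcendental.PadicLogPrincipalUnits
import Literature.NumberTheory.LocalFields.PadicExpLogHomomorphisms
import Literature.NumberTheory.EllipticCurves.PAdicOneVariableSupportOfColemanTraceTwo
import Literature.NumberTheory.GaloisRepresentations.LubinTateComparisonAddPoints
import Literature.NumberTheory.GaloisRepresentations.LubinTateColemanRelativeInterpolationTwo
import Literature.NumberTheory.GaloisRepresentations.LubinTateColemanRelativeAnomalyTwo
import Literature.NumberTheory.GaloisRepresentations.LubinTateComparisonReflectionTwo
import Literature.NumberTheory.GaloisRepresentations.LubinTateComparisonTraceTransportRelTwo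
import Literature.NumberTheory.EllipticCurves.PAdicOneVariableSeriesFamilyOfRelNormCoherentUnits
import HarnessLib

/-!
# STUB IDEAS — `stub_heegnerIndexLowerAtTwo`, ideator k = 1, gen 43 (technique: weaken / strengthen)

Crux `PrintCf2.SplitBadTwoLowerHalfOfFacts` (stmt-BirchSwinnertonDyer-27851), skeleton sha `f2bd84c0…`, road B′.
**BSD is NOT proved by any of this; the stub `stub_heegnerIndexLowerAtTwo` and the crux are NOT proved.**
Node (STUB-PLAN v7.9 / CRITIC-ROWS-g44 row 125): the junction R219-INST₂-CORE **(γ′) ⊕ (δ)** — the last glue of the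
REFL table atom before R220-CUT (K60: creditable, XS–S).  HARDEST (a) = the x-law is untouched here (declared).

## The lens, applied to (γ′) ⊕ (δ)

* WEAKEST SUFFICIENT FORM (PART M §A, Mathlib-only, PROVED).  In k3-g40's `read₂_of_refl_cut` the seam
  `hS2 : Lg (e γ) = T γ` is consumed only through the unit identity `V(eγ) − c = κ·(T γ − T(γ·γ₀))`; hence the
  EXACT content of (γ′) ⊕ (δ) is ONE identity per unit class (`read₂_of_unit_identity`, with the converse
  `diffSeam_of_read₂`), and the seam is needed only MODULO `γ₀`-PERIODIC TABLES
  (`read₂_of_refl_cut_of_seam_mod_periodic`; the freedom is exactly that: `reflTable_eq_iff_periodic`).  With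
  `γ₀ = 1 + 2^n` the `γ₀`-periodic tables are precisely the tables pulled back from level `n`
  (`periodic_of_level`), and they are invisible to every character with `ψ(γ₀) = −1` (`sum_mul_periodic_eq_zero`)
  — so the "same normalisation on both sides" obligation of (γ′) (row 125) is VACUOUS: constants, layer constants,
  anything factoring through `(ℤ/2^n)ˣ` may differ between `Lg` and `T`.
* STRONGEST PROVABLE FORM of the (δ)-side (PART M §C–§D, PROVED over the tree + the verbatim parts): the hS1-input of
  `read₂_of_refl_cut` holds ON THE NOSE at every `Ĝ_m`-reflecting pair `z' = −2 − z` of `𝔪_ℂ`: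
  `V_β(z) = ½·(Lg_β z − Lg_β z') + c_β` (`readingValue_eq_half_sub`), where `V_β(z) = ½·plog θ(P_β(ϑ̄ z))` is the value
  of the reading witness (k1-g41 (α), here with a z-UNIFORM witness `inst₂_core_uniform`), `c_β = gaugeConst β`, and
  `Lg_β w = plog θ(g̃_β(ϑ̄ w))` on the PRINCIPAL normalisation `g̃_β = g_β/g_β(0)` (log-branch remark (β′)).  The engine is
  a hypothesis-free ℂ_F-side reflection law `evS_map_reflE` : `(τ_E G)(y) = G(−π' − y)` (the tree's
  `evS_map_reflect_of_reflE_eq_neg` without its `hr`), k1-g41's `Q_β · τ_E g_β = g_β`, and the tree's `ϑ(−2 [+] z) = refl`.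
* (δ) ASSEMBLED (PART M §D, PROVED): for `n ≥ 1`, ANY reflecting torsion family `z : ℤ/2^{n+1} → 𝔪_ℂ`
  (`1 + z_{a+2^n} = −(1 + z_a)`; existence from a `ζ` with `ζ^{2^n} = −1`: `exists_isReflectingFamily`) and ANY table
  `T` on `(ℤ/2^{n+1})ˣ` congruent to `Lg_β ∘ z` modulo a `γ₀`-periodic table, `RamifiedReading` (k3-g38's input) holds
  with `Γ = (ℤ/2^{n+1})ˣ`, `e = refl`, `s = 2^n`, `γ₀ = 1 + 2^n`, `κ = ½`, `V₂ = −c_β` (`delta_read₂`), and the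
  consumer's character sum is `Σ_γ ψ(γ)·T γ` (`delta_charSum`, via critic g41 `refl_table_charSum`).
* WHAT REMAINS of (γ′), TYPED AND REDUCED IN KERNEL (PART M §E): the obligation is `SeamModLevel` (E1: `Lg_β∘z ≡ T`
  modulo level-`n` tables; E1′ = what (δ) consumes).  It holds with `C = 0` for the untwisted log table
  `T γ = plog θ(ḡ_β(0)⁻¹·ι τ_γ β_n)` (E2) as soon as the VALUE IDENTIFICATION `ι(τ_γ β_n) = ḡ_β(ϑ̄ z_γ)` holds (E3 ⟹ E1:
  `seamModLevel_of_valueIdentification`, PROVED), and the value identification follows (E7, PROVED: tree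
  `evS_relColemanSeries` + k3-g40 `exists_untwisted_table` at `k = 0` + the transport `coe_evS_gC_eq` = tree `map_evS`,
  E5 PROVED) from k3-g40's typed sub-stub `LocalUntwistExists` and the ONE remaining input, typed here as
  **`PacketMatching`** (E6): `ϑ̄(z_γ) = ι(σ_{v_γ} ω_{n+1})` in `𝒪_ℂ` — the comparison isomorphism carries the `Ĝ_m`
  torsion packet onto de Shalit's coherent Lubin–Tate packet.  So (γ′) ⊕ (δ) = `LocalUntwistExists` ⊕ `PacketMatching`
  ⊕ (kernel, this file); the additive / level-`n` normalisation of (γ′) is free (§A).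

Hypotheses beyond the frame of record: `hθlt : ‖x‖ < 1 → ‖θ x‖ < 1` (continuity-type; needed so that `θ` of a
principal unit of `𝒪_ℂ` is a principal unit of `ℂ₂` — `hθ1` alone does not give it), and `1 ≤ n`
(`1 + 2^0 = 2` is not a unit mod `2`).  No `sorry`, no new axioms.

## Credits (verbatim parts — crux workfiles are not importable, B74; sha16 of the sources in the crux directory)
Part V0 = k3-g40 `STUB_IDEAS_…_3_g40.lean` §1 ll. 49–119 (`2333f3139e2b61f4`); Parts V1–V5 = k1-g41
`STUB_IDEAS_…_1_g41.lean` ll. 58–961 (`3c421c26b5d9a924`; themselves carrying k3-g40 §2–§3, k2-g41 §D–§E, k3-g39 §D/§E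
excerpts, critic g42 J10, and k1-g41's own PART M); Part V6 = critic g41 `critic_k3g40_K3_reflsum.lean` ll. 16–81
(`c85c8fc2ad323e66`); Part V7 = k3-g40 §4 ll. 363–495 (`ActsAsFrobPow`, `LocalUntwistExists`, `exists_untwisted_table`;
same source file).  PART M (namespace `…WeakSeamK1G43`) is new.  Literature: [cite: deShalit1987, Ch. I §3.3 (7),
§3.8, Ch. II §4.12–4.14]; [cite: Rubin1991, §7]; [cite: CasselsFrohlichANT1967, Ch. VI §3.2]; tree modules as imported.
-/

noncomputable section

set_option linter.dupNamespace false
set_option linter.unusedSectionVars false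
set_option linter.unusedVariables false
set_option linter.unnecessarySimpa false

open scoped PowerSeries.WithPiTopology

namespace Summit.BirchSwinnertonDyer.BirchSwinnertonDyer.Cruxes.SplitBadTwoLowerHalfOfFacts.ReadTwoCutK3G40

/-! ### PART V0 — VERBATIM from k3-g40 `STUB_IDEAS_stub_heegnerIndexLowerAtTwo_3_g40.lean` (sha16 `2333f3139e2b61f4`), §1 (ll. 49–119): the glue of record `RamifiedReading`, `UnitReading`, `read₂_of_cut`, `read₂_of_refl_cut` (credit: k3-g40; B74 copy). -/

/-! ## §1. The glue (Mathlib-only, PROVED): READ₂ ⟸ one identity on units ⟸ the four sub-stub value identities -/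

section Glue

variable {R' : Type*} [CommRing R'] {N : ℕ} [NeZero N]

/-- `RamifiedReading` — VERBATIM the consumer's input (k3-g38 `atom_shape`): two-term structure + unit covariance. -/
def RamifiedReading {M : ℕ} (hMN : M ∣ N) (V V₁ : ZMod N → R') (V₂ : ZMod M → R')
    {Γ : Type*} (e : Γ ≃ (ZMod N)ˣ) (ℓ : Γ → R') : Prop :=
  (∀ j : ZMod N, V j = V₁ j - V₂ (ZMod.castHom hMN (ZMod M) j)) ∧ ∀ γ : Γ, V₁ (e γ : ZMod N) = ℓ γ

/-- **The content of READ₂ is ONE identity on units**: `V(eγ) + V₂(eγ mod M) = ℓ(γ)`. -/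
def UnitReading {M : ℕ} (hMN : M ∣ N) (V : ZMod N → R') (V₂ : ZMod M → R')
    {Γ : Type*} (e : Γ ≃ (ZMod N)ˣ) (ℓ : Γ → R') : Prop :=
  ∀ γ : Γ, V (e γ : ZMod N) + V₂ (ZMod.castHom hMN (ZMod M) (e γ : ZMod N)) = ℓ γ

/-- `UnitReading ⟹ RamifiedReading` with `V₁ := V + V₂ ∘ cast` (conjunct 1 becomes definitional). -/
theorem ramifiedReading_of_unitReading {M : ℕ} (hMN : M ∣ N) {V : ZMod N → R'} {V₂ : ZMod M → R'}
    {Γ : Type*} {e : Γ ≃ (ZMod N)ˣ} {ℓ : Γ → R'} (h : UnitReading hMN V V₂ e ℓ) :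
    RamifiedReading hMN V (fun j => V j + V₂ (ZMod.castHom hMN (ZMod M) j)) V₂ e ℓ :=
  ⟨fun j => (add_sub_cancel_right _ _).symm, fun γ => h γ⟩

/-- … and conversely: ANY ramified reading yields the unit identity (so nothing is lost by the normal form). -/
theorem unitReading_of_ramifiedReading {M : ℕ} (hMN : M ∣ N) {V V₁ : ZMod N → R'} {V₂ : ZMod M → R'}
    {Γ : Type*} {e : Γ ≃ (ZMod N)ˣ} {ℓ : Γ → R'} (h : RamifiedReading hMN V V₁ V₂ e ℓ) :
    UnitReading hMN V V₂ e ℓ := fun γ => by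
  rw [h.1 (e γ : ZMod N), sub_add_cancel, h.2 γ]

/-- ★ **THE CUT GLUE `read₂_of_cut`.**  Value tables on `(ℤ/N)ˣ` (`N = 2^{n+1}`, `M = 2^n`):
`Λv a` = value of the primitive series `log̃ g_b ∘ ϑ` at `ζ^a − 1`; `Lg a = plog g_b(w_a)` (`w_a = ϑ(ζ^a−1)`);
`Lφ m = plog g_b^φ(w'_m)` (`w'_{a mod M} = f′(w_a)`, level `n`); `T γ` = the untwisted table (`log` of `σ_γ(b_n)`).
S1 (pullback, up to the period `Ω⁻¹` and an additive constant) + S4 (Λ-split) + S3 (transport: the `½`-term factors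
through `a mod M`) + S2 (untwist on units) ⟹ `UnitReading`, hence `RamifiedReading`. -/
theorem unitReading_of_cut {M : ℕ} (hMN : M ∣ N) {Γ : Type*} (e : Γ ≃ (ZMod N)ˣ)
    (V : ZMod N → R') (Λv Lg Lφ' : (ZMod N)ˣ → R') (Lφ : ZMod M → R') (T : Γ → R') (Ωinv half c : R')
    (hS1 : ∀ a : (ZMod N)ˣ, V (a : ZMod N) = Ωinv * Λv a + c)
    (hS4 : ∀ a : (ZMod N)ˣ, Λv a = Lg a - half * Lφ' a)
    (hS3 : ∀ a : (ZMod N)ˣ, Lφ' a = Lφ (ZMod.castHom hMN (ZMod M) (a : ZMod N)))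
    (hS2 : ∀ γ : Γ, Lg (e γ) = T γ) :
    UnitReading hMN V (fun m => Ωinv * half * Lφ m - c) e (fun γ => Ωinv * T γ) := fun γ => by
  simp only [hS1, hS4, hS3, hS2]
  ring

/-- READ₂ from the cut. -/
theorem read₂_of_cut {M : ℕ} (hMN : M ∣ N) {Γ : Type*} (e : Γ ≃ (ZMod N)ˣ)
    (V : ZMod N → R') (Λv Lg Lφ' : (ZMod N)ˣ → R') (Lφ : ZMod M → R') (T : Γ → R') (Ωinv half c : R')
    (hS1 : ∀ a : (ZMod N)ˣ, V (a : ZMod N) = Ωinv * Λv a + c)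
    (hS4 : ∀ a : (ZMod N)ˣ, Λv a = Lg a - half * Lφ' a)
    (hS3 : ∀ a : (ZMod N)ˣ, Lφ' a = Lφ (ZMod.castHom hMN (ZMod M) (a : ZMod N)))
    (hS2 : ∀ γ : Γ, Lg (e γ) = T γ) :
    RamifiedReading hMN V (fun j => V j + (Ωinv * half * Lφ (ZMod.castHom hMN (ZMod M) j) - c))
      (fun m => Ωinv * half * Lφ m - c) e (fun γ => Ωinv * T γ) :=
  ramifiedReading_of_unitReading hMN (unitReading_of_cut hMN e V Λv Lg Lφ' Lφ T Ωinv half c hS1 hS4 hS3 hS2)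

/-- ★ **THE CUT GLUE, REFL SHAPE (presentation of record, row 115: `V j = κ·(ℓ_j − ℓ_{j+s}) + c`, `s = 2^n`,
`V₂ = −c` CONSTANT).**  `Lg a = plog θ g_b(w_a)`; the shift `a ↦ a + s` is multiplication by a fixed `γ₀ ∈ Γ`
(`ζ^{a+2^n} = −ζ^a`, `γ₀ ↔ −1`); S1 (pullback + EVAL₂-REFL: `½·plog Q(w_a) = ½(ℓ_a − ℓ_{a+s})`) + S2 (untwist on
units) ⟹ `RamifiedReading` with constant `V₂`. -/
theorem read₂_of_refl_cut {M : ℕ} (hMN : M ∣ N) {Γ : Type*} [Mul Γ] (e : Γ ≃ (ZMod N)ˣ)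
    (V Lg : ZMod N → R') (T : Γ → R') (κ c : R') (s : ZMod N) (γ₀ : Γ)
    (hshift : ∀ γ : Γ, ((e (γ * γ₀) : (ZMod N)ˣ) : ZMod N) = (e γ : ZMod N) + s)
    (hS1 : ∀ a : ZMod N, V a = κ * (Lg a - Lg (a + s)) + c)
    (hS2 : ∀ γ : Γ, Lg (e γ : ZMod N) = T γ) :
    RamifiedReading hMN V (fun j : ZMod N => V j + -c) (fun _ : ZMod M => -c) e
      (fun γ => κ * (T γ - T (γ * γ₀))) := by
  have h : UnitReading hMN V (fun _ : ZMod M => -c) e (fun γ => κ * (T γ - T (γ * γ₀))) := fun γ => by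
    simp only [hS1, ← hshift, hS2]
    ring
  exact ramifiedReading_of_unitReading hMN h

end Glue

end Summit.BirchSwinnertonDyer.BirchSwinnertonDyer.Cruxes.SplitBadTwoLowerHalfOfFacts.ReadTwoCutK3G40

/-! ### PARTS V1–V5 — VERBATIM from k1-g41 `STUB_IDEAS_stub_heegnerIndexLowerAtTwo_1_g41.lean` (sha16 `3c421c26b5d9a924`), ll. 58–961 (its Parts V1–V4 = k3-g40 §2–§3, k2-g41 §D–§E, k3-g39 §D/§E excerpts, critic g42 J10, credited there; its PART M = namespace `InstCoreK1G41`; credit: k1-g41 and the authors it names; B74 copy). -/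

namespace Summit.BirchSwinnertonDyer.BirchSwinnertonDyer.Cruxes.SplitBadTwoLowerHalfOfFacts.ReadTwoCutK3G40

/-! ### PART V1 — VERBATIM from k3-g40 `STUB_IDEAS_stub_heegnerIndexLowerAtTwo_3_g40.lean` (sha16 `2333f3139e2b61f4`), §2 (ll. 126–226) and §3 (ll. 233–361): the consumers of record `tsum_coeff_map_subst_mul_pow_eq`, `lambda_value_refl_evS`, `read_value_eq_tsum_lamTerm` (credit: k3-g40; copied because workfiles are not importable — B74). -/

section LambdaSplit

open Literature.NumberTheory.Transcendental

variable {𝕜 : Type*} [NontriviallyNormedField 𝕜] [NormedAlgebra ℚ_[2] 𝕜] [IsUltrametricDist 𝕜] [CompleteSpace 𝕜]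

/-- `‖2‖ = ½` in a normed `ℚ₂`-algebra. -/
theorem norm_two : ‖(2 : 𝕜)‖ = 2⁻¹ := by
  have h := IwasawaLog.norm_natCast (F := 𝕜) 2 2
  have hp : ‖((2 : ℕ) : ℚ_[2])‖ = ((2 : ℕ) : ℝ)⁻¹ := Padic.norm_p
  simp only [Nat.cast_ofNat] at h hp
  rw [h, hp]

theorem two_ne_zero' : (2 : 𝕜) ≠ 0 := by
  intro h
  have := norm_two (𝕜 := 𝕜)
  rw [h, norm_zero] at this
  norm_num at this

/-- The terms of `Λ₂` at `t`: `(−1)^d · 2^d/(d+1) · t^{d+1}` (`= logScalar 2 (d+1) · t^{d+1}` in k1-g37's notation). -/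
def lamTerm (t : 𝕜) (d : ℕ) : 𝕜 := (-1) ^ d * (2 : 𝕜) ^ d / ((d : 𝕜) + 1) * t ^ (d + 1)

/-- Term bound on the CLOSED unit ball: `‖lamTerm t d‖ ≤ (d+1)·2^{−d}`. -/
theorem norm_lamTerm_le {t : 𝕜} (ht : ‖t‖ ≤ 1) (d : ℕ) :
    ‖lamTerm t d‖ ≤ ((d : ℝ) + 1) * (2⁻¹ : ℝ) ^ d := by
  unfold lamTerm
  have hinv : ‖((d : 𝕜) + 1)⁻¹‖ ≤ (d : ℝ) + 1 := by
    have h := IwasawaLog.norm_inv_natCast_le (F := 𝕜) 2 (n := d + 1) (Nat.succ_ne_zero d)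
    push_cast at h
    exact h
  rw [div_eq_mul_inv, norm_mul, norm_mul, norm_mul, norm_pow, norm_pow, norm_neg, norm_one, one_pow, one_mul,
    norm_two, norm_pow]
  calc (2⁻¹ : ℝ) ^ d * ‖((d : 𝕜) + 1)⁻¹‖ * ‖t‖ ^ (d + 1)
      ≤ (2⁻¹ : ℝ) ^ d * ((d : ℝ) + 1) * 1 := by
        gcongr
        exact pow_le_one₀ (norm_nonneg _) ht
    _ = ((d : ℝ) + 1) * (2⁻¹ : ℝ) ^ d := by ring

/-- `Λ₂(t)` converges for `‖t‖ ≤ 1`. -/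
theorem summable_lamTerm {t : 𝕜} (ht : ‖t‖ ≤ 1) : Summable (lamTerm t) := by
  have hr : ‖(2⁻¹ : ℝ)‖ < 1 := by rw [norm_inv, Real.norm_ofNat]; norm_num
  have hg : Summable fun d : ℕ => ((d : ℝ) + 1) * (2⁻¹ : ℝ) ^ d := by
    have h1 : Summable fun d : ℕ => ((d : ℝ) ^ 1) * (2⁻¹ : ℝ) ^ d := summable_pow_mul_geometric_of_norm_lt_one 1 hr
    have h0 : Summable fun d : ℕ => (2⁻¹ : ℝ) ^ d := summable_geometric_of_norm_lt_one hr
    simpa [pow_one, add_mul] using h1.add h0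
  exact Summable.of_norm_bounded hg (norm_lamTerm_le ht)

/-- `½ · plog(1 + 2t) = Σ' lamTerm t` (rescaling the defining Mercator series termwise). -/
theorem half_mul_plog_one_add_two_mul (t : 𝕜) :
    (2 : 𝕜)⁻¹ * PadicExp.plog (1 + 2 * t) = ∑' d, lamTerm t d := by
  rw [Literature.NumberTheory.LocalFields.plog_one_add_eq_tsum, ← tsum_mul_left]
  refine tsum_congr fun d => ?_
  unfold lamTerm
  have h2 : (2 : 𝕜) ≠ 0 := two_ne_zero'
  rw [mul_pow, pow_succ (2 : 𝕜)]
  field_simp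

/-- ★ `HasSum (lamTerm t) (½ · plog (1 + 2t))` on the closed unit ball. -/
theorem hasSum_lamTerm {t : 𝕜} (ht : ‖t‖ ≤ 1) :
    HasSum (lamTerm t) ((2 : 𝕜)⁻¹ * PadicExp.plog (1 + 2 * t)) := by
  rw [half_mul_plog_one_add_two_mul]
  exact (summable_lamTerm ht).hasSum

/-- `plog (x² · y⁻¹) = 2·plog x − plog y` on principal units. -/
theorem plog_sq_mul_inv {x y : 𝕜} (hx : ‖1 - x‖ < 1) (hy : ‖1 - y‖ < 1) :
    PadicExp.plog (x ^ 2 * y⁻¹) = 2 * PadicExp.plog x - PadicExp.plog y := by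
  rw [PadicExp.plog_mul (ℓ := 2) (IwasawaLog.norm_one_sub_pow_lt hx 2) (IwasawaLog.norm_one_sub_inv_lt hy),
    PadicExp.plog_pow (ℓ := 2) hx 2, PadicExp.plog_inv (ℓ := 2) hy]
  push_cast
  ring

/-- `plog` of a quotient of principal units: `q·r = x ⟹ plog q = plog x − plog r` (REFL form: `Q_β · τ_E g = g`
evaluated at a point). -/
theorem plog_eq_sub_of_mul_eq {x q r : 𝕜} (hq : ‖1 - q‖ < 1) (hr : ‖1 - r‖ < 1) (h : q * r = x) :
    PadicExp.plog q = PadicExp.plog x - PadicExp.plog r := by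
  rw [← h, PadicExp.plog_mul (ℓ := 2) hq hr]
  ring

/-- ★ **S4, REFL FORM (row 114's witness `½·logOf V_β`, `V_β ≡ 1 (mod 2)` by H6): `P = 1 + 2t` ⟹ `Λ₂(t) = ½·plog P`**
— the defining Mercator series on the closed ball, nothing else. -/
theorem lambda_value_refl {P t : 𝕜} (ht : ‖t‖ ≤ 1) (hP : P = 1 + 2 * t) :
    ∑' d, lamTerm t d = (2 : 𝕜)⁻¹ * PadicExp.plog P := by
  rw [hP]
  exact (hasSum_lamTerm ht).tsum_eq

/-- ★★ **S4 — THE Λ-SPLIT AT A POINT.**  `x = g(w)`, `y = g^φ(f′w)` principal units, `t = y_g(w)` integral with the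
EVALUATED congruence `x² = y(1 + 2t)` (a ring-hom image of k1-g37's `exists_unitRatio` datum), and `L` the value of the
convergent integral series `Λ₂ ∘ y_g` at `w` (§3 identifies it with `Σ' lamTerm t`): then `L = plog x − ½ plog y`. -/
theorem lambda_value_split {x y t L : 𝕜} (hx : ‖1 - x‖ < 1) (hy : ‖1 - y‖ < 1) (ht : ‖t‖ ≤ 1)
    (hfac : x ^ 2 = y * (1 + 2 * t)) (hL : HasSum (lamTerm t) L) :
    L = PadicExp.plog x - (2 : 𝕜)⁻¹ * PadicExp.plog y := by
  have hy1 : ‖y‖ = 1 := IwasawaLog.norm_eq_one_of_norm_one_sub_lt hy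
  have hy0 : y ≠ 0 := by
    intro h; rw [h, norm_zero] at hy1; exact zero_ne_one hy1
  have h2 : (2 : 𝕜) ≠ 0 := two_ne_zero'
  have hquot : 1 + 2 * t = x ^ 2 * y⁻¹ := by
    rw [hfac]; field_simp
  rw [hL.unique (hasSum_lamTerm ht), hquot, plog_sq_mul_inv hx hy]
  field_simp

end LambdaSplit

section TreeEvaluation

open ValuativeRel IsLocalRing Field
open Literature.NumberTheory.GaloisRepresentations Literature.NumberTheory.GaloisRepresentations.IsNonarchimedeanLocalField
  Literature.NumberTheory.GaloisRepresentations.LubinTate Literature.NumberTheory.PAdicHodge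
  Literature.NumberTheory.EllipticCurves

variable {F : Type} [Field F] [ValuativeRel F] [TopologicalSpace F] [IsNonarchimedeanLocalField F]

attribute [local instance] ltNormUniformSpace ltNormIsUniformAddGroup rk1 nF nE fintypeResidueField

/-- ★ **SUBST–EVAL at a point of `𝔪_ℂ`, in `ℂ_F`**: the value of `R ∘ φ` at `z` is the value of `R` at `φ(z)`. -/
theorem tsum_coeff_subst_mul_pow_eq (R φ : PowerSeries (CBall F)) (hφ : PowerSeries.constantCoeff φ = 0)
    (z : (maxNilIdealC F).toIdeal) :
    ∑' m : ℕ, ((PowerSeries.coeff m (PowerSeries.subst φ R) : CBall F) : CompletedAlgClosure F) *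
        ((z : CBall F) : CompletedAlgClosure F) ^ m =
      ∑' d : ℕ, ((PowerSeries.coeff d R : CBall F) : CompletedAlgClosure F) *
        ((evS (maxNilIdealC F) z φ : CBall F) : CompletedAlgClosure F) ^ d := by
  have h := tsum_coeff_mul_pow_eq_evS R ⟨evS (maxNilIdealC F) z φ, evS_mem_of_constantCoeff_eq_zero _ z hφ⟩
  rw [tsum_coeff_mul_pow_eq_evS, evS_subst (maxNilIdealC F) z hφ R]
  exact h.symm

/-- ★ the same pushed along `θ : ℂ_F → ℂ_2` (the currency of `prints_family_def_two`). -/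
theorem tsum_coeff_map_subst_mul_pow_eq (θ : CompletedAlgClosure F →+* ℂ_[2]) (hθc : Continuous θ)
    (R φ : PowerSeries (CBall F)) (hφ : PowerSeries.constantCoeff φ = 0) (z : (maxNilIdealC F).toIdeal) :
    ∑' m : ℕ, PowerSeries.coeff m (PowerSeries.map (θ.comp (CBall F).subtype) (PowerSeries.subst φ R)) *
        (θ ((z : CBall F) : CompletedAlgClosure F)) ^ m =
      ∑' d : ℕ, PowerSeries.coeff d (PowerSeries.map (θ.comp (CBall F).subtype) R) *
        (θ ((evS (maxNilIdealC F) z φ : CBall F) : CompletedAlgClosure F)) ^ d := by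
  have h := (hasSum_map_coeff_mul_pow θ hθc R
    ⟨evS (maxNilIdealC F) z φ, evS_mem_of_constantCoeff_eq_zero _ z hφ⟩).tsum_eq
  rw [(hasSum_map_coeff_mul_pow θ hθc _ z).tsum_eq, evS_subst (maxNilIdealC F) z hφ R]
  exact h.symm

/-- Values of a principal series (`g(0) = 1`) at points of `𝔪_ℂ` are principal units of `ℂ_F`. -/
theorem norm_one_sub_evS_lt_one (g : PowerSeries (CBall F)) (hg : PowerSeries.constantCoeff g = 1)
    (z : (maxNilIdealC F).toIdeal) :
    ‖(1 : CompletedAlgClosure F) - ((evS (maxNilIdealC F) z g : CBall F) : CompletedAlgClosure F)‖ < 1 := by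
  have h0 : PowerSeries.constantCoeff (g - 1) = 0 := by rw [map_sub, hg, map_one, sub_self]
  have hmem : evS (maxNilIdealC F) z (g - 1) ∈ (maxNilIdealC F).toIdeal :=
    evS_mem_of_constantCoeff_eq_zero _ z h0
  have hlt : ‖((evS (maxNilIdealC F) z (g - 1) : CBall F) : CompletedAlgClosure F)‖ < 1 := hmem
  have hval : ((evS (maxNilIdealC F) z g : CBall F) : CompletedAlgClosure F) =
      1 + ((evS (maxNilIdealC F) z (g - 1) : CBall F) : CompletedAlgClosure F) := by
    rw [map_sub, map_one]; push_cast; ring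
  rw [hval, sub_add_cancel_left, norm_neg]
  exact hlt

/-- The congruence datum EVALUATES: `g² = G·(1 + 2y)` in `𝒪_ℂ⟦X⟧` ⟹ `g(z)² = G(z)·(1 + 2·y(z))`. -/
theorem evS_sq_eq_of_factorisation {g G y : PowerSeries (CBall F)}
    (h : g ^ 2 = G * (1 + PowerSeries.C (2 : CBall F) * y)) (z : (maxNilIdealC F).toIdeal) :
    (evS (maxNilIdealC F) z g) ^ 2 = evS (maxNilIdealC F) z G * (1 + 2 * evS (maxNilIdealC F) z y) := by
  have := congrArg (evS (maxNilIdealC F) z) h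
  simpa [map_pow, map_mul, map_add, map_one, evS_C] using this

/-- ★ **S4 ASSEMBLED IN THE TREE'S CURRENCY** (composite of §2 and §3): for principal `g, G ∈ 𝒪_ℂ⟦X⟧`, integral `y`
with `g² = G(1+2y)`, points `w` of `𝔪_ℂ`, and `θ : ℂ_F → ℂ_2` continuous, of norm `≤ 1` on `𝒪_ℂ` and mapping `𝔪_ℂ`
into the open unit ball (all three hold for the `θ` of record, `norm_equivPadicComplex_lt_one_iff`):
the value `Σ' lamTerm (θ y(w))` IS `plog θ(g(w)) − ½ plog θ(G(w))`. -/
theorem lambda_value_split_evS (θ : CompletedAlgClosure F →+* ℂ_[2])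
    (hθ1 : ∀ z : CBall F, ‖θ (z : CompletedAlgClosure F)‖ ≤ 1)
    (hθlt : ∀ x : CompletedAlgClosure F, ‖x‖ < 1 → ‖θ x‖ < 1)
    {g G y : PowerSeries (CBall F)} (hg : PowerSeries.constantCoeff g = 1) (hG : PowerSeries.constantCoeff G = 1)
    (h : g ^ 2 = G * (1 + PowerSeries.C (2 : CBall F) * y)) (w : (maxNilIdealC F).toIdeal) :
    ∑' d, lamTerm (θ ((evS (maxNilIdealC F) w y : CBall F) : CompletedAlgClosure F)) d =
      Literature.NumberTheory.Transcendental.PadicExp.plog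
          (θ ((evS (maxNilIdealC F) w g : CBall F) : CompletedAlgClosure F)) -
        (2 : ℂ_[2])⁻¹ * Literature.NumberTheory.Transcendental.PadicExp.plog
          (θ ((evS (maxNilIdealC F) w G : CBall F) : CompletedAlgClosure F)) := by
  have hx : ‖1 - θ ((evS (maxNilIdealC F) w g : CBall F) : CompletedAlgClosure F)‖ < 1 := by
    rw [← map_one θ, ← map_sub]; exact hθlt _ (norm_one_sub_evS_lt_one g hg w)
  have hy : ‖1 - θ ((evS (maxNilIdealC F) w G : CBall F) : CompletedAlgClosure F)‖ < 1 := by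
    rw [← map_one θ, ← map_sub]; exact hθlt _ (norm_one_sub_evS_lt_one G hG w)
  have ht : ‖θ ((evS (maxNilIdealC F) w y : CBall F) : CompletedAlgClosure F)‖ ≤ 1 := hθ1 _
  have hfac := congrArg (fun s : CBall F => θ (s : CompletedAlgClosure F)) (evS_sq_eq_of_factorisation h w)
  simp only [Subring.coe_mul, SubmonoidClass.coe_pow, Subring.coe_add, Subring.coe_one, map_mul, map_pow,
    map_add, map_one] at hfac
  have h2 : θ (((2 : CBall F) : CBall F) : CompletedAlgClosure F) = 2 := by
    rw [show (((2 : CBall F) : CBall F) : CompletedAlgClosure F) = 2 by norm_cast, map_ofNat]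
  rw [h2] at hfac
  exact lambda_value_split hx hy ht hfac (summable_lamTerm ht).hasSum

/-- ★ **S4 (REFL presentation of record) IN THE TREE'S CURRENCY**: for `P = 1 + 2y ∈ 𝒪_ℂ⟦X⟧` (`P =` the reflection
quotient `Q_β = g_β/τ_E g_β` normalised to `Q(0) = 1`; `Q_β ≡ 1 (mod π')` is k3-g39's PROVED `reflQuot_sub_one_mem` /
`transportedCongruence_holds`) and `w ∈ 𝔪_ℂ`: `Σ' lamTerm (θ y(w)) = ½·plog θ(P(w))`.  With `tsum_coeff_map_subst_mul_pow_eq`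
this is R221 «EVAL₂» for the witness `½·logOf P = Λ₂(y)` (`logOf_one_add_two_smul`, §5): NO `logOf`-evaluation API. -/
theorem lambda_value_refl_evS (θ : CompletedAlgClosure F →+* ℂ_[2])
    (hθ1 : ∀ z : CBall F, ‖θ (z : CompletedAlgClosure F)‖ ≤ 1)
    {P y : PowerSeries (CBall F)} (hP : P = 1 + PowerSeries.C (2 : CBall F) * y) (w : (maxNilIdealC F).toIdeal) :
    ∑' d, lamTerm (θ ((evS (maxNilIdealC F) w y : CBall F) : CompletedAlgClosure F)) d =
      (2 : ℂ_[2])⁻¹ * Literature.NumberTheory.Transcendental.PadicExp.plog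
          (θ ((evS (maxNilIdealC F) w P : CBall F) : CompletedAlgClosure F)) := by
  have ht : ‖θ ((evS (maxNilIdealC F) w y : CBall F) : CompletedAlgClosure F)‖ ≤ 1 := hθ1 _
  have hev : evS (maxNilIdealC F) w P = 1 + 2 * evS (maxNilIdealC F) w y := by
    have := congrArg (evS (maxNilIdealC F) w) hP
    simpa [map_mul, map_add, map_one, evS_C] using this
  have hfac := congrArg (fun s : CBall F => θ (s : CompletedAlgClosure F)) hev
  simp only [Subring.coe_mul, Subring.coe_add, Subring.coe_one, map_mul, map_add, map_one] at hfac
  have h2 : θ (((2 : CBall F) : CBall F) : CompletedAlgClosure F) = 2 := by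
    rw [show (((2 : CBall F) : CBall F) : CompletedAlgClosure F) = 2 by norm_cast, map_ofNat]
  rw [h2] at hfac
  exact lambda_value_refl ht hfac

/-- ★★ **R221 «EVAL₂» — THE VALUE OF THE READING WITNESS, CLOSED IN KERNEL.**  For any `L ∈ 𝒪_ℂ⟦X⟧` whose
`θ`-coefficients are the `Λ₂` scalars (`θ[X⁰]L = 0`, `θ[X^{d+1}]L = (−1)^d 2^d/(d+1)`; existence: `coeff_Lam2_succ` + the
integrality `‖2^d/(d+1)‖₂ ≤ 1` of `norm_lamTerm_le`) and any `y ∈ 𝒪_ℂ⟦X⟧` with `y(0) = 0`, the `θ`-value at `z ∈ 𝔪_ℂ` of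
the composite `L∘y` (the series the reading actually evaluates, after `∘ϑ` which is one more `tsum_coeff_map_subst_mul_pow_eq`)
is `Σ' lamTerm (θ y(z))` — hence `½·plog θ P(z)` (REFL, `lambda_value_refl_evS`) or `plog θ g(z) − ½·plog θ G(z)` (FROB,
`lambda_value_split_evS`).  Ingredients: tree `evS_subst`, `hasSum_map_coeff_mul_pow`; one reindexing.  No `logOf`-evaluation
theorem, no radius-of-convergence bookkeeping. -/
theorem read_value_eq_tsum_lamTerm (θ : CompletedAlgClosure F →+* ℂ_[2]) (hθc : Continuous θ)
    (L y : PowerSeries (CBall F)) (hy : PowerSeries.constantCoeff y = 0)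
    (hL0 : θ ((PowerSeries.coeff 0 L : CBall F) : CompletedAlgClosure F) = 0)
    (hL : ∀ d : ℕ, θ ((PowerSeries.coeff (d + 1) L : CBall F) : CompletedAlgClosure F) =
      (-1) ^ d * (2 : ℂ_[2]) ^ d / ((d : ℂ_[2]) + 1))
    (z : (maxNilIdealC F).toIdeal) :
    ∑' m : ℕ, PowerSeries.coeff m (PowerSeries.map (θ.comp (CBall F).subtype) (PowerSeries.subst y L)) *
        (θ ((z : CBall F) : CompletedAlgClosure F)) ^ m =
      ∑' d : ℕ, lamTerm (θ ((evS (maxNilIdealC F) z y : CBall F) : CompletedAlgClosure F)) d := by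
  rw [tsum_coeff_map_subst_mul_pow_eq θ hθc L y hy z]
  have hs := (hasSum_map_coeff_mul_pow θ hθc L
    ⟨evS (maxNilIdealC F) z y, evS_mem_of_constantCoeff_eq_zero _ z hy⟩).summable
  rw [hs.tsum_eq_zero_add]
  simp only [PowerSeries.coeff_map, RingHom.coe_comp, Function.comp_apply, Subring.coe_subtype]
  rw [hL0, zero_mul, zero_add]
  refine tsum_congr fun d => ?_
  rw [hL d, lamTerm]

end TreeEvaluation

end Summit.BirchSwinnertonDyer.BirchSwinnertonDyer.Cruxes.SplitBadTwoLowerHalfOfFacts.ReadTwoCutK3G40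
namespace Summit.BirchSwinnertonDyer.BirchSwinnertonDyer.Cruxes.SplitBadTwoLowerHalfOfFacts.DisjointShiftK2G41

/-! ### PART V2 — VERBATIM from k2-g41 `STUB_IDEAS_stub_heegnerIndexLowerAtTwo_2_g41.lean` (sha16 `cd4b39d39d1ff210`), §D `LamTwoLift` (ll. 402–494) and §E `HalfLift` (ll. 499–514): the INST₂ leaves H3 / H1 of record (credit: k2-g41). -/

section LamTwoLift

/-- Odd naturals are units in norm: `‖m‖ = 1` for `m` odd, in any ultrametric normed field with `‖2‖ < 1`. -/
theorem norm_natCast_eq_one_of_odd {L : Type*} [NormedField L] [IsUltrametricDist L] (h2 : ‖(2 : L)‖ < 1)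
    {m : ℕ} (hm : Odd m) : ‖(m : L)‖ = 1 := by
  obtain ⟨k, rfl⟩ := hm
  have hk : ‖(2 * k : L)‖ < 1 := by
    rw [norm_mul]
    calc ‖(2 : L)‖ * ‖(k : L)‖ ≤ ‖(2 : L)‖ * 1 := by
          gcongr
          exact IsUltrametricDist.norm_natCast_le_one L k
      _ < 1 := by rw [mul_one]; exact h2
  have hne : ‖(2 * k : L)‖ ≠ ‖(1 : L)‖ := by rw [norm_one]; exact hk.ne
  rw [Nat.cast_add, Nat.cast_mul, Nat.cast_two, Nat.cast_one,
    IsUltrametricDist.norm_add_eq_max_of_norm_ne_norm hne, norm_one, max_eq_right hk.le]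

/-- ★ `‖2^d/(d+1)‖ ≤ 1` (`d+1 = 2^v·m`, `m` odd, `2^v ≤ d+1 ≤ 2^d`). -/
theorem norm_two_pow_div_le_one {L : Type*} [NormedField L] [IsUltrametricDist L] (h2 : ‖(2 : L)‖ < 1)
    (d : ℕ) : ‖(2 : L) ^ d / ((d : L) + 1)‖ ≤ 1 := by
  obtain ⟨v, m, hm, hvm⟩ := Nat.exists_eq_two_pow_mul_odd (Nat.succ_ne_zero d)
  have hd1 : ((d : L) + 1) = (2 : L) ^ v * (m : L) := by
    have h := congrArg (Nat.cast : ℕ → L) hvm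
    push_cast at h
    exact h
  have hv : v ≤ d := by
    have h1 : 2 ^ v ≤ d + 1 := by
      calc 2 ^ v ≤ 2 ^ v * m := Nat.le_mul_of_pos_right _ hm.pos
        _ = d + 1 := hvm.symm
    exact (Nat.pow_le_pow_iff_right (by norm_num)).mp (h1.trans Nat.lt_two_pow_self)
  rw [norm_div, hd1, norm_mul, norm_natCast_eq_one_of_odd h2 hm, mul_one, norm_pow, norm_pow]
  exact div_le_one_of_le₀ (pow_le_pow_of_le_one (norm_nonneg _) h2.le hv) (by positivity)

open Literature.NumberTheory.GaloisRepresentations Literature.NumberTheory.GaloisRepresentations.IsNonarchimedeanLocalField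
  Literature.NumberTheory.GaloisRepresentations.LubinTate Literature.NumberTheory.PAdicHodge

variable {F : Type} [Field F] [ValuativeRel F] [TopologicalSpace F] [IsNonarchimedeanLocalField F]

/-- The `Λ₂`-coefficient `(−1)^d 2^d/(d+1)` as an element of `𝒪_{ℂ_F}`. -/
def lamCoeff (h2 : ‖(2 : CompletedAlgClosure F)‖ < 1) (d : ℕ) : CBall F :=
  ⟨(-1) ^ d * (2 : CompletedAlgClosure F) ^ d / ((d : CompletedAlgClosure F) + 1),
    (mem_unitBall_iff _).mpr (by
      rw [mul_div_assoc, norm_mul, norm_pow, norm_neg, norm_one, one_pow, one_mul]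
      exact norm_two_pow_div_le_one h2 d)⟩

/-- The integral lift `L = Σ_{d≥0} (−1)^d 2^d/(d+1) · X^{d+1} ∈ 𝒪_{ℂ_F}⟦X⟧` of `Λ₂ = ½ log(1 + 2X)`. -/
def Lam2C (h2 : ‖(2 : CompletedAlgClosure F)‖ < 1) : PowerSeries (CBall F) :=
  PowerSeries.mk fun n => if n = 0 then 0 else lamCoeff h2 (n - 1)

theorem coeff_zero_Lam2C (h2 : ‖(2 : CompletedAlgClosure F)‖ < 1) : PowerSeries.coeff 0 (Lam2C h2) = 0 := by
  rw [Lam2C, PowerSeries.coeff_mk, if_pos rfl]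

theorem coeff_succ_Lam2C (h2 : ‖(2 : CompletedAlgClosure F)‖ < 1) (d : ℕ) :
    ((PowerSeries.coeff (d + 1) (Lam2C h2) : CBall F) : CompletedAlgClosure F) =
      (-1) ^ d * (2 : CompletedAlgClosure F) ^ d / ((d : CompletedAlgClosure F) + 1) := by
  rw [Lam2C, PowerSeries.coeff_mk, if_neg (Nat.succ_ne_zero d), Nat.add_sub_cancel]
  rfl

/-- ★ **H3 «Λ₂-LIFT» (k3-g40 P3) PROVED**: in residue characteristic `2` (`‖2‖_{ℂ_F} < 1`, tree `norm_two_lt_one_C h2`)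
there is `L ∈ 𝒪_{ℂ_F}⟦X⟧` with `L(0) = 0` and `[X^{d+1}]L = (−1)^d 2^d/(d+1)`. -/
theorem exists_Lam2_lift (h2 : ‖(2 : CompletedAlgClosure F)‖ < 1) :
    ∃ L : PowerSeries (CBall F), ((PowerSeries.coeff 0 L : CBall F) : CompletedAlgClosure F) = 0 ∧
      ∀ d : ℕ, ((PowerSeries.coeff (d + 1) L : CBall F) : CompletedAlgClosure F) =
        (-1) ^ d * (2 : CompletedAlgClosure F) ^ d / ((d : CompletedAlgClosure F) + 1) :=
  ⟨Lam2C h2, by rw [coeff_zero_Lam2C]; rfl, coeff_succ_Lam2C h2⟩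

/-- ★ The same in the EXACT hypothesis shape of k3-g40's `read_value_eq_tsum_lamTerm` (`hL0`, `hL`), for any ring
map `θ : ℂ_F → M` into a field (there `M = ℂ_[2]`). -/
theorem exists_Lam2_lift_map (h2 : ‖(2 : CompletedAlgClosure F)‖ < 1) {M : Type*} [Field M]
    (θ : CompletedAlgClosure F →+* M) :
    ∃ L : PowerSeries (CBall F), θ ((PowerSeries.coeff 0 L : CBall F) : CompletedAlgClosure F) = 0 ∧
      ∀ d : ℕ, θ ((PowerSeries.coeff (d + 1) L : CBall F) : CompletedAlgClosure F) =
        (-1) ^ d * (2 : M) ^ d / ((d : M) + 1) := by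
  refine ⟨Lam2C h2, ?_, fun d => ?_⟩
  · rw [coeff_zero_Lam2C]; exact map_zero θ
  · rw [coeff_succ_Lam2C, map_div₀, map_mul, map_pow, map_pow, map_neg, map_one, map_add, map_natCast, map_one,
      map_ofNat]

/-- ★ Coefficientwise form matching k3-g40's `coeff_Lam2` (`Lam2 A := mk fun n ↦ if n = 0 then 0 else
algebraMap ℚ A ((−1)^{n+1} 2^{n−1}/n)`): under any ring map `θ` into a characteristic-0 field `M`,
`θ(L) = Lam2 M` coefficient by coefficient — i.e. `(Lam2C).map (θ ∘ subtype) = Lam2 M`. -/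
theorem map_coeff_Lam2C (h2 : ‖(2 : CompletedAlgClosure F)‖ < 1) {M : Type*} [Field M] [CharZero M]
    (θ : CompletedAlgClosure F →+* M) (n : ℕ) :
    θ ((PowerSeries.coeff n (Lam2C h2) : CBall F) : CompletedAlgClosure F) =
      if n = 0 then 0 else algebraMap ℚ M ((-1 : ℚ) ^ (n + 1) * 2 ^ (n - 1) / n) := by
  cases n with
  | zero => rw [if_pos rfl, coeff_zero_Lam2C]; exact map_zero θ
  | succ d =>
    rw [if_neg (Nat.succ_ne_zero d), coeff_succ_Lam2C, map_div₀, map_mul, map_pow, map_pow, map_neg, map_one,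
      map_add, map_natCast, map_one, map_ofNat, Nat.add_sub_cancel, eq_ratCast]
    push_cast
    ring

end LamTwoLift

section HalfLift

theorem exists_eq_one_add_C_mul {A : Type*} [CommRing A] (a : A) (P : PowerSeries A)
    (hP0 : PowerSeries.constantCoeff P = 1) (hP : ∀ n : ℕ, a ∣ PowerSeries.coeff (n + 1) P) :
    ∃ y : PowerSeries A, PowerSeries.constantCoeff y = 0 ∧ P = 1 + PowerSeries.C a * y := by
  classical
  choose c hc using hP
  refine ⟨PowerSeries.mk fun n => if n = 0 then 0 else c (n - 1), ?_, ?_⟩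
  · rw [← PowerSeries.coeff_zero_eq_constantCoeff_apply, PowerSeries.coeff_mk, if_pos rfl]
  · ext n
    rw [map_add, PowerSeries.coeff_one, PowerSeries.coeff_C_mul, PowerSeries.coeff_mk]
    cases n with
    | zero => rw [if_pos rfl, if_pos rfl, mul_zero, add_zero, PowerSeries.coeff_zero_eq_constantCoeff_apply, hP0]
    | succ k => rw [if_neg (Nat.succ_ne_zero k), if_neg (Nat.succ_ne_zero k), zero_add, Nat.add_sub_cancel, hc k]

end HalfLift

end Summit.BirchSwinnertonDyer.BirchSwinnertonDyer.Cruxes.SplitBadTwoLowerHalfOfFacts.DisjointShiftK2G41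
namespace Summit.BirchSwinnertonDyer.BirchSwinnertonDyer.Cruxes.SplitBadTwoLowerHalfOfFacts.ReflectionPrimitiveK3G39

open Literature.NumberTheory.EllipticCurves

/-! ### PART V3 — VERBATIM EXCERPT from k3-g39 `STUB_IDEAS_stub_heegnerIndexLowerAtTwo_3_g39.lean` (sha16 `a08256b05cf54030`): §D ll. 334–347 (section header), 380–387 (`gUnit`, `reflQuot`), 406–421 (`reflQuot_sub_one_mem`, PROVED), §E ll. 445–470 (`readΘ`, `transport`) — decls token-identical, unrelated decls of those sections omitted (credit: k3-g39). -/

section Reflection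

open Literature.NumberTheory.GaloisRepresentations
open Literature.NumberTheory.GaloisRepresentations.IsNonarchimedeanLocalField
open Literature.NumberTheory.GaloisRepresentations.LubinTate ValuativeRel Field

variable {F : Type} [Field F] [ValuativeRel F] [TopologicalSpace F] [IsNonarchimedeanLocalField F]

attribute [local instance] ltNormUniformSpace ltNormIsUniformAddGroup rk1 nF nE fintypeResidueField

variable {π : 𝒪[F]} (hπ : (valuation F).IsUniformizer (π : F))
variable (E : IntermediateField F (AlgebraicClosure F)) [FiniteDimensional F E] [Normal F E] [IsGalois F E]
variable (hq : residueFieldCard F = 2) (hE : E ≤ maxUnramified F) {σ₀ : absoluteGaloisGroup F} (hσ₀ : IsAbsArithFrob σ₀)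

/-- The relative Coleman series `g_β` as a unit of `𝒪_E⟦X⟧`. [cite: deShalit1987, Ch. I §2.3] -/
def gUnit (β : RelNormCoherentUnits hπ E) : (PowerSeries (unitBall E))ˣ :=
  (isUnit_relColemanSeries hπ E hq hE hσ₀ β).unit

/-- ★ **THE REFLECTION QUOTIENT `Q_β := g_β / τ_E g_β = g_β(X) / g_β(−π−X)`** (a unit of `𝒪_E⟦X⟧`). -/
def reflQuot (β : RelNormCoherentUnits hπ E) : (PowerSeries (unitBall E))ˣ :=
  gUnit hπ E hq hE hσ₀ β * (reflEUnit hπ E (gUnit hπ E hq hE hσ₀ β))⁻¹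

/-- ★ **REFLECTION CONGRUENCE**: `Q_β ≡ 1 (mod π)` coefficientwise — from the tree's `τ_E G ≡ G (mod π)`
(`reflE_sub_self_mem_span`: `X [+] ω₁ − X = −2X − π ∈ (π)` as `2 = π t`). [cite: deShalit1987, Ch. I §3.12] -/
theorem reflQuot_sub_one_mem (β : RelNormCoherentUnits hπ E) :
    (reflQuot hπ E hq hE hσ₀ β : PowerSeries (unitBall E)) - 1 ∈
      coeffIdeal (Ideal.span {algebraMap 𝒪[F] (unitBall E) π}) := by
  have hτ := reflE_sub_self_mem_span hπ E hq (gUnit hπ E hq hE hσ₀ β : PowerSeries (unitBall E))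
  have hinv : (reflEUnit hπ E (gUnit hπ E hq hE hσ₀ β) : PowerSeries (unitBall E)) *
      ↑(reflEUnit hπ E (gUnit hπ E hq hE hσ₀ β))⁻¹ = 1 := Units.mul_inv _
  -- `Q − 1 = −(τg − g) · (τg)⁻¹`
  have e : (reflQuot hπ E hq hE hσ₀ β : PowerSeries (unitBall E)) - 1 =
      -(reflE hπ E (gUnit hπ E hq hE hσ₀ β : PowerSeries (unitBall E)) - ↑(gUnit hπ E hq hE hσ₀ β)) *
        ↑(reflEUnit hπ E (gUnit hπ E hq hE hσ₀ β))⁻¹ := by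
    rw [reflQuot, Units.val_mul, ← coe_reflEUnit]
    linear_combination hinv
  rw [e]
  exact Ideal.mul_mem_right _ _ (neg_mem hτ)

end Reflection

section Transport

open Literature.NumberTheory.GaloisRepresentations
open Literature.NumberTheory.GaloisRepresentations.IsNonarchimedeanLocalField
open Literature.NumberTheory.GaloisRepresentations.LubinTate ValuativeRel Field
open Literature.NumberTheory.PAdicHodge

variable {F : Type} [Field F] [ValuativeRel F] [TopologicalSpace F] [IsNonarchimedeanLocalField F]

attribute [local instance] ltNormUniformSpace ltNormIsUniformAddGroup rk1 nF nE fintypeResidueField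

variable (h2 : (valuation F).IsUniformizer (((2 : ℕ) : 𝒪[F]) : F)) (u : 𝒪[F]ˣ)
variable (E : IntermediateField F (AlgebraicClosure F)) [FiniteDimensional F E] [Normal F E] [IsGalois F E]
  (hq : residueFieldCard F = 2) (hE : E ≤ maxUnramified F) {σ₀ : absoluteGaloisGroup F} (hσ₀ : IsAbsArithFrob σ₀)
  (j : unitBall E →+* UnrCoeff F)
variable {ε : (maxUnramifiedCompletion F)ˣ}
  (hε : maxUnramifiedCompletion.galAut F σ₀ (ε : maxUnramifiedCompletion F) =
    algebraMap 𝒪[F] (maxUnramifiedCompletion F) (u : 𝒪[F]) * (ε : maxUnramifiedCompletion F))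
variable (θ : CompletedAlgClosure F →+* ℂ_[2])

/-- The reading map `Θ = θ ∘ (𝒪_{ℂ_F} ⊆ ℂ_F) ∘ (𝐃 → 𝒪_{ℂ_F}) : 𝐃 → ℂ₂` of the family of record. -/
def readΘ : UnrCoeff F →+* ℂ_[2] := θ.comp ((CBall F).subtype.comp (algebraMap (UnrCoeff F) (CBall F)))

/-- The TRANSPORT `L(G) := Θ(j(G) ∘ ϑ) : 𝒪_E⟦X⟧ → ℂ₂⟦S⟧` of the family of record (`H_β = L((δ_E g_β)~)`). -/
def transport (G : PowerSeries (unitBall E)) : PowerSeries ℂ_[2] :=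
  (PowerSeries.subst (compSeriesC h2 hσ₀ u hε) (G.map j)).map (readΘ θ)

end Transport

end Summit.BirchSwinnertonDyer.BirchSwinnertonDyer.Cruxes.SplitBadTwoLowerHalfOfFacts.ReflectionPrimitiveK3G39
namespace Summit.BirchSwinnertonDyer.BirchSwinnertonDyer.Cruxes.SplitBadTwoLowerHalfOfFacts.CriticG42

/-! ### PART V4 — VERBATIM EXCERPT from the critic's `critic_g42_junction.lean` (sha16 `0240c8426823ff9b`): section header ll. 2449–2457 and ★★ J10 `inst₂_leaves_assembled` ll. 2521–2538 — THE CONSUMER OF RECORD of R219-INST₂-CORE (α) (credit: critic g42). -/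

section LeavesJunction

open ValuativeRel IsLocalRing Field
open Literature.NumberTheory.GaloisRepresentations Literature.NumberTheory.GaloisRepresentations.IsNonarchimedeanLocalField
  Literature.NumberTheory.GaloisRepresentations.LubinTate Literature.NumberTheory.PAdicHodge

variable {F : Type} [Field F] [ValuativeRel F] [TopologicalSpace F] [IsNonarchimedeanLocalField F]

attribute [local instance] ltNormUniformSpace ltNormIsUniformAddGroup rk1 nF nE fintypeResidueField

/-- ★★ J10 «THE INST₂ LEAVES ASSEMBLED» (k2-g41 H1 ⊕ H3 ⊕ k3-g40 R221 ⊕ S4-REFL): for the reflection quotient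
`P ∈ 𝒪_ℂ⟦X⟧` with `P(0) = 1` and `2 ∣ [X^{n+1}]P`, the reading witness `L∘y` EXISTS in `𝒪_ℂ⟦X⟧` and its `θ`-value
at every `z ∈ 𝔪_ℂ` IS `½·plog θ P(z)` — hypothesis-free except the frame (`θ` continuous & integral, `‖2‖_ℂ < 1`).
What remains of R219-INST₂ after this is witness-specific only: the `∘ϑ` line, `V = L_b + c`, SEAM, ONE application. -/
theorem inst₂_leaves_assembled (θ : CompletedAlgClosure F →+* ℂ_[2]) (hθc : Continuous θ)
    (hθ1 : ∀ z : CBall F, ‖θ (z : CompletedAlgClosure F)‖ ≤ 1) (h2 : ‖(2 : CompletedAlgClosure F)‖ < 1)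
    (P : PowerSeries (CBall F)) (hP0 : PowerSeries.constantCoeff P = 1)
    (hP : ∀ n : ℕ, (2 : CBall F) ∣ PowerSeries.coeff (n + 1) P) (z : (maxNilIdealC F).toIdeal) :
    ∃ L y : PowerSeries (CBall F), PowerSeries.constantCoeff y = 0 ∧ P = 1 + PowerSeries.C (2 : CBall F) * y ∧
      θ ((PowerSeries.coeff 0 L : CBall F) : CompletedAlgClosure F) = 0 ∧
      ∑' m : ℕ, PowerSeries.coeff m (PowerSeries.map (θ.comp (CBall F).subtype) (PowerSeries.subst y L)) *
          (θ ((z : CBall F) : CompletedAlgClosure F)) ^ m =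
        (2 : ℂ_[2])⁻¹ * Literature.NumberTheory.Transcendental.PadicExp.plog
          (θ ((evS (maxNilIdealC F) z P : CBall F) : CompletedAlgClosure F)) := by
  obtain ⟨y, hy0, hPy⟩ := DisjointShiftK2G41.exists_eq_one_add_C_mul (2 : CBall F) P hP0 hP
  obtain ⟨L, hL0, hL⟩ := DisjointShiftK2G41.exists_Lam2_lift_map h2 θ
  exact ⟨L, y, hy0, hPy, hL0, (ReadTwoCutK3G40.read_value_eq_tsum_lamTerm θ hθc L y hy0 hL0 hL z).trans
    (ReadTwoCutK3G40.lambda_value_refl_evS θ hθ1 hPy z)⟩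

end LeavesJunction

end Summit.BirchSwinnertonDyer.BirchSwinnertonDyer.Cruxes.SplitBadTwoLowerHalfOfFacts.CriticG42
/-! ## PART M — NEW (k1-g41): R219-INST₂-CORE (α) «the `∘ϑ̄`-line instance at `P := Q_β`» CLOSED IN THE KERNEL,
plus the (β)-KEY (gauge constant) and the identification with k3-g39's transport `V_β`.

Technique «weaken / strengthen»: the WEAKEST hypothesis under which the consumer of record J10
(`CriticG42.inst₂_leaves_assembled`) fires is `P(0) = 1 ∧ ∀ n, 2 ∣ [X^{n+1}]P` in `𝒪_ℂ⟦X⟧` (divisibility currency);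
the STRONGEST thing the tree/k3-g39 produce about the witness is `Q_β − 1 ∈ coeffIdeal (π')` in `𝒪_E⟦X⟧`
(ideal currency, `π' = u·2`).  §A is the currency bridge (pure algebra), §B the unit/principal-unit facts in `𝒪_ℂ`,
§C the witness `Q̄_β`, its gauge unit `a_β = Q̄_β(0)` and the normalised `P_β := a_β⁻¹·Q̄_β` (J10's `P`), §D the
junction (α), §E the (β)-key and the identification `θ(Q̄_β∘ϑ̄) = transport (reflQuot β)`, §F the log-branch remark
and degenerate checks.  BSD is NOT proved by any of this. -/

namespace Summit.BirchSwinnertonDyer.BirchSwinnertonDyer.Cruxes.SplitBadTwoLowerHalfOfFacts.InstCoreK1G41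

/-! ### §A  The currency bridge `coeffIdeal (span {a}) ⟷ (a ∣ coefficients)` — pure commutative algebra. -/
section Algebra

open PowerSeries
open Literature.NumberTheory.GaloisRepresentations.LubinTate (coeffIdeal mem_coeffIdeal_iff)

variable {A B : Type*} [CommRing A] [CommRing B]

/-- Functoriality of `coeffIdeal` under `PowerSeries.map`. -/
theorem map_mem_coeffIdeal_map (f : A →+* B) {J : Ideal A} {G : PowerSeries A} (hG : G ∈ coeffIdeal J) :
    G.map f ∈ coeffIdeal (J.map f) :=
  mem_coeffIdeal_iff.mpr fun n => by
    rw [coeff_map]; exact Ideal.mem_map_of_mem f (mem_coeffIdeal_iff.mp hG n)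

/-- … in the `G − 1 ∈ coeffIdeal (span {a})` shape of k3-g39's `reflQuot_sub_one_mem`. -/
theorem map_sub_one_mem_coeffIdeal_span (f : A →+* B) {a : A} {G : PowerSeries A}
    (hG : G - 1 ∈ coeffIdeal (Ideal.span {a})) : G.map f - 1 ∈ coeffIdeal (Ideal.span {f a}) := by
  have h := map_mem_coeffIdeal_map f hG
  rw [map_sub, map_one, Ideal.map_span, Set.image_singleton] at h
  exact h

/-- `coeffIdeal J` is stable under substitution of a substitutable series (k3-g39's pattern, l. 601). -/
theorem subst_mem_coeffIdeal {φ : PowerSeries A} (hφ : PowerSeries.HasSubst φ) {J : Ideal A} {G : PowerSeries A}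
    (hG : G ∈ coeffIdeal J) : PowerSeries.subst φ G ∈ coeffIdeal J :=
  mem_coeffIdeal_iff.mpr fun n => by
    rw [PowerSeries.coeff_subst' hφ]
    exact finsum_induction (· ∈ J) J.zero_mem (fun _ _ hx hy => J.add_mem hx hy)
      fun d => by rw [smul_eq_mul]; exact J.mul_mem_right _ (mem_coeffIdeal_iff.mp hG d)

/-- … in the `G − 1` shape: the congruence `G ≡ 1` survives `∘φ` (the `∘ϑ̄` line never spends the congruence). -/
theorem subst_sub_one_mem_coeffIdeal {φ : PowerSeries A} (hφ : PowerSeries.HasSubst φ) {J : Ideal A}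
    {G : PowerSeries A} (hG : G - 1 ∈ coeffIdeal J) : PowerSeries.subst φ G - 1 ∈ coeffIdeal J := by
  have h := subst_mem_coeffIdeal hφ hG
  rw [← PowerSeries.coe_substAlgHom hφ] at h ⊢
  rw [map_sub, map_one] at h
  exact h

/-- RE-GAUGE: the congruence ideal sees the generator only up to units (`π' = u·2 ↦ 2`). -/
theorem span_singleton_unit_mul_eq {v : A} (hv : IsUnit v) (a : A) :
    Ideal.span ({v * a} : Set A) = Ideal.span {a} :=
  Ideal.span_singleton_mul_left_unit hv a

theorem coeff_zero_sub_one (P : PowerSeries A) :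
    PowerSeries.coeff 0 (P - 1) = PowerSeries.constantCoeff P - 1 := by
  rw [map_sub, PowerSeries.coeff_zero_eq_constantCoeff_apply, PowerSeries.coeff_zero_one]

theorem coeff_succ_sub_one (P : PowerSeries A) (n : ℕ) :
    PowerSeries.coeff (n + 1) (P - 1) = PowerSeries.coeff (n + 1) P := by
  rw [map_sub, PowerSeries.coeff_one, if_neg (Nat.succ_ne_zero n), sub_zero]

/-- ★ **THE CURRENCY BRIDGE**: ideal currency (k3-g39 / tree `coeffIdeal`) ⟺ divisibility currency (J10's
`hP0`/`hP`).  The WEAKEST form J10 needs is the right-hand side with `P(0) − 1 = 0`. -/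
theorem sub_one_mem_coeffIdeal_span_iff {a : A} {P : PowerSeries A} :
    P - 1 ∈ coeffIdeal (Ideal.span {a}) ↔
      (a ∣ PowerSeries.constantCoeff P - 1) ∧ ∀ n : ℕ, a ∣ PowerSeries.coeff (n + 1) P := by
  rw [mem_coeffIdeal_iff]
  constructor
  · intro h
    exact ⟨by rw [← coeff_zero_sub_one]; exact Ideal.mem_span_singleton.mp (h 0),
      fun n => by rw [← coeff_succ_sub_one P n]; exact Ideal.mem_span_singleton.mp (h (n + 1))⟩
  · rintro ⟨h0, hs⟩ n
    cases n with
    | zero => rw [coeff_zero_sub_one]; exact Ideal.mem_span_singleton.mpr h0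
    | succ n => rw [coeff_succ_sub_one]; exact Ideal.mem_span_singleton.mpr (hs n)

/-- NORMALISATION of the constant term by a unit (the gauge `a ↦ 1`). -/
theorem constantCoeff_C_inv_mul (a : Aˣ) {P : PowerSeries A} (hP : PowerSeries.constantCoeff P = a) :
    PowerSeries.constantCoeff (PowerSeries.C ((↑a⁻¹ : A)) * P) = 1 := by
  rw [map_mul, PowerSeries.constantCoeff_C, hP, Units.inv_mul]

/-- … which does not disturb the divisibility of the higher coefficients. -/
theorem dvd_coeff_succ_C_mul (c : A) {a : A} {P : PowerSeries A}
    (hP : ∀ n : ℕ, a ∣ PowerSeries.coeff (n + 1) P) (n : ℕ) :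
    a ∣ PowerSeries.coeff (n + 1) (PowerSeries.C c * P) := by
  rw [PowerSeries.coeff_C_mul]; exact Dvd.dvd.mul_left (hP n) c

/-- Degenerate check (B68-style): `P = 1` satisfies the weakest form trivially. -/
example (a : A) : (1 : PowerSeries A) - 1 ∈ coeffIdeal (Ideal.span {a}) := by
  rw [sub_self]; exact (coeffIdeal (Ideal.span {a})).zero_mem

/-- Sanity check of the bridge on `P = 1 + C a · X`: constant coefficient `1`, `a ∣` every higher coefficient. -/
example (a : A) : (1 + PowerSeries.C a * PowerSeries.X : PowerSeries A) - 1 ∈ coeffIdeal (Ideal.span {a}) := by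
  refine sub_one_mem_coeffIdeal_span_iff.mpr ⟨?_, fun n => ?_⟩
  · simp
  · rw [map_add, PowerSeries.coeff_one, if_neg (Nat.succ_ne_zero n), zero_add, PowerSeries.coeff_C_mul,
      PowerSeries.coeff_X]
    split_ifs
    · exact ⟨1, by ring⟩
    · exact ⟨0, by ring⟩

end Algebra

/-! ### §B  Units and principal units of `𝒪_ℂ = CBall F`, read through `θ : ℂ_F → ℂ₂` with `‖θ‖ ≤ 1` on `𝒪_ℂ` only. -/
section Ball

open ValuativeRel IsLocalRing Field
open Literature.NumberTheory.Transcendental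
open Literature.NumberTheory.GaloisRepresentations Literature.NumberTheory.GaloisRepresentations.IsNonarchimedeanLocalField
  Literature.NumberTheory.GaloisRepresentations.LubinTate Literature.NumberTheory.PAdicHodge

variable {F : Type} [Field F] [ValuativeRel F] [TopologicalSpace F] [IsNonarchimedeanLocalField F]

/-- `‖2‖ < 1` in `ℂ₂` (k3-g40's `norm_two`). -/
theorem norm_two_C2_lt_one : ‖(2 : ℂ_[2])‖ < 1 := by
  rw [ReadTwoCutK3G40.norm_two]; norm_num

/-- `2 ∣ a − 1` in `𝒪_ℂ` ⟹ `‖a − 1‖ < 1` in `ℂ_F`. -/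
theorem norm_sub_one_lt_one_of_two_dvd (h2 : ‖(2 : CompletedAlgClosure F)‖ < 1) {a : CBall F}
    (ha : (2 : CBall F) ∣ a - 1) : ‖((a : CBall F) : CompletedAlgClosure F) - 1‖ < 1 := by
  obtain ⟨t, ht⟩ := ha
  have e2 : ((2 : CBall F) : CompletedAlgClosure F) = 2 := map_ofNat (CBall F).subtype 2
  have e : (a : CompletedAlgClosure F) - 1 = 2 * (t : CompletedAlgClosure F) := by
    have := congrArg (fun s : CBall F => (s : CompletedAlgClosure F)) ht
    push_cast at this
    rw [e2] at this
    exact this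
  rw [e, norm_mul]
  calc ‖(2 : CompletedAlgClosure F)‖ * ‖(t : CompletedAlgClosure F)‖
      ≤ ‖(2 : CompletedAlgClosure F)‖ * 1 := by gcongr; exact (mem_unitBall_iff _).mp t.2
    _ < 1 := by rw [mul_one]; exact h2

/-- ★ principal elements of `𝒪_ℂ` are UNITS of `𝒪_ℂ` (the gauge constant `a_β = Q̄_β(0)` is invertible in `𝒪_ℂ`). -/
theorem isUnit_of_norm_sub_one_lt_one {a : CBall F}
    (ha : ‖((a : CBall F) : CompletedAlgClosure F) - 1‖ < 1) : IsUnit a := by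
  have ha1 : ‖(a : CompletedAlgClosure F)‖ = 1 :=
    IwasawaLog.norm_eq_one_of_norm_one_sub_lt (by rwa [norm_sub_rev] at ha)
  have ha0 : (a : CompletedAlgClosure F) ≠ 0 := fun h => by
    rw [h, norm_zero] at ha1; exact zero_ne_one ha1
  let b : CBall F := ⟨(a : CompletedAlgClosure F)⁻¹, (mem_unitBall_iff _).mpr (by rw [norm_inv, ha1, inv_one])⟩
  exact IsUnit.of_mul_eq_one b (Subtype.ext (mul_inv_cancel₀ ha0))

variable (θ : CompletedAlgClosure F →+* ℂ_[2]) (hθ1 : ∀ z : CBall F, ‖θ (z : CompletedAlgClosure F)‖ ≤ 1)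

include hθ1 in
/-- `2 ∣ a − 1` in `𝒪_ℂ` ⟹ `θ(a)` is a principal unit of `ℂ₂` — uses `hθ1` ONLY (no `hθlt`, cf. K-rule R221). -/
theorem norm_one_sub_map_lt_one_of_two_dvd {a : CBall F} (ha : (2 : CBall F) ∣ a - 1) :
    ‖1 - θ ((a : CBall F) : CompletedAlgClosure F)‖ < 1 := by
  obtain ⟨t, ht⟩ := ha
  have e2 : ((2 : CBall F) : CompletedAlgClosure F) = 2 := map_ofNat (CBall F).subtype 2
  have e : (a : CompletedAlgClosure F) = 1 + 2 * (t : CompletedAlgClosure F) := by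
    have := congrArg (fun s : CBall F => (s : CompletedAlgClosure F)) ht
    push_cast at this
    rw [e2] at this
    linear_combination this
  rw [e, map_add, map_one, map_mul, map_ofNat,
    show (1 : ℂ_[2]) - (1 + 2 * θ (t : CompletedAlgClosure F)) = -(2 * θ (t : CompletedAlgClosure F)) by ring,
    norm_neg, norm_mul]
  calc ‖(2 : ℂ_[2])‖ * ‖θ (t : CompletedAlgClosure F)‖ ≤ ‖(2 : ℂ_[2])‖ * 1 := by gcongr; exact hθ1 t
    _ < 1 := by rw [mul_one]; exact norm_two_C2_lt_one

/-- `2 ∣ P(w) − 1` in `𝒪_ℂ` for `P(0) = 1`, `2 ∣ [X^{n+1}]P`, `w ∈ 𝔪_ℂ` (via k2-g41's half-lift `P = 1 + 2y`). -/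
theorem two_dvd_evS_sub_one {P : PowerSeries (CBall F)} (hP0 : PowerSeries.constantCoeff P = 1)
    (hP : ∀ n : ℕ, (2 : CBall F) ∣ PowerSeries.coeff (n + 1) P) (w : (maxNilIdealC F).toIdeal) :
    (2 : CBall F) ∣ evS (maxNilIdealC F) w P - 1 := by
  obtain ⟨y, -, hPy⟩ := DisjointShiftK2G41.exists_eq_one_add_C_mul (2 : CBall F) P hP0 hP
  refine ⟨evS (maxNilIdealC F) w y, ?_⟩
  rw [hPy, map_add, map_one, map_mul, evS_C, add_sub_cancel_left]

end Ball

/-! ### §C  The witness: `ϑ̄`, `Q̄_β`, the gauge unit `a_β`, the normalised quotient `P_β`. -/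
section Witness

open ValuativeRel IsLocalRing Field
open Literature.NumberTheory.Transcendental
open Literature.NumberTheory.GaloisRepresentations Literature.NumberTheory.GaloisRepresentations.IsNonarchimedeanLocalField
  Literature.NumberTheory.GaloisRepresentations.LubinTate Literature.NumberTheory.PAdicHodge
  Literature.NumberTheory.EllipticCurves

variable {F : Type} [Field F] [ValuativeRel F] [TopologicalSpace F] [IsNonarchimedeanLocalField F]

attribute [local instance] ltNormUniformSpace ltNormIsUniformAddGroup rk1 nF nE fintypeResidueField

variable (hq : residueFieldCard F = 2) (h2 : (valuation F).IsUniformizer (((2 : ℕ) : 𝒪[F]) : F)) (u : 𝒪[F]ˣ)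
variable (E : IntermediateField F (AlgebraicClosure F)) [FiniteDimensional F E] [Normal F E] [IsGalois F E]
  (hE : E ≤ maxUnramified F) {σ₀ : absoluteGaloisGroup F} (hσ₀ : IsAbsArithFrob σ₀)
variable {ε : (maxUnramifiedCompletion F)ˣ}
  (hε : maxUnramifiedCompletion.galAut F σ₀ (ε : maxUnramifiedCompletion F) =
    algebraMap 𝒪[F] (maxUnramifiedCompletion F) (u : 𝒪[F]) * (ε : maxUnramifiedCompletion F))
variable (θ : CompletedAlgClosure F →+* ℂ_[2]) (hθc : Continuous θ)
  (hθ1 : ∀ z : CBall F, ‖θ (z : CompletedAlgClosure F)‖ ≤ 1)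

/-- `ϑ̄` — the comparison series of record read in `𝒪_ℂ⟦S⟧` (the tree's currency for points of the family:
`evalPt₁_compSeriesC_eq_mk_evS`).  It is `j`-FREE. -/
def thetaBar : PowerSeries (CBall F) := (compSeriesC h2 hσ₀ u hε).map (algebraMap (UnrCoeff F) (CBall F))

theorem constantCoeff_thetaBar : PowerSeries.constantCoeff (thetaBar h2 u hσ₀ hε) = 0 :=
  constantCoeff_map_compSeriesC hσ₀ u hε h2

theorem hasSubst_thetaBar : PowerSeries.HasSubst (thetaBar h2 u hσ₀ hε) :=
  PowerSeries.HasSubst.of_constantCoeff_zero' (constantCoeff_thetaBar h2 u hσ₀ hε)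

/-- `Q̄_β` — k3-g39's reflection quotient `Q_β = g_β / τ_E g_β` read in `𝒪_ℂ⟦X⟧` along `𝒪_E → 𝒪_ℂ`
(`unitBallToCBall E`).  It is `j`-FREE. -/
def reflQuotC (β : RelNormCoherentUnits (isUniformizer_unit_mul h2 u) E) : PowerSeries (CBall F) :=
  (ReflectionPrimitiveK3G39.reflQuot (isUniformizer_unit_mul h2 u) E hq hE hσ₀ β : PowerSeries (unitBall E)).map
    (unitBallToCBall E)

/-- The congruence generator `π' = u·2` of the frame, read in `𝒪_ℂ`, is `(unit)·2`. -/
theorem unitBallToCBall_algebraMap_generator :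
    unitBallToCBall E (algebraMap 𝒪[F] (unitBall E) ((u : 𝒪[F]) * ((2 : ℕ) : 𝒪[F]))) =
      unitBallToCBall E (algebraMap 𝒪[F] (unitBall E) (u : 𝒪[F])) * 2 := by
  rw [map_mul, map_mul, map_natCast, map_natCast, Nat.cast_ofNat]

theorem isUnit_unitBallToCBall_algebraMap_unit :
    IsUnit (unitBallToCBall E (algebraMap 𝒪[F] (unitBall E) (u : 𝒪[F]))) :=
  (u.isUnit.map _).map _

/-- ★ STRONGEST AVAILABLE, RE-GAUGED: `Q̄_β − 1 ∈ coeffIdeal (2)` in `𝒪_ℂ⟦X⟧` — k3-g39's `reflQuot_sub_one_mem`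
(ideal `(π')` of `𝒪_E`) pushed along `𝒪_E → 𝒪_ℂ` (`map_sub_one_mem_coeffIdeal_span`) and re-gauged `(u·2) = (2)`. -/
theorem reflQuotC_sub_one_mem (β : RelNormCoherentUnits (isUniformizer_unit_mul h2 u) E) :
    reflQuotC hq h2 u E hE hσ₀ β - 1 ∈ coeffIdeal (Ideal.span {(2 : CBall F)}) := by
  have h := map_sub_one_mem_coeffIdeal_span (unitBallToCBall E)
    (ReflectionPrimitiveK3G39.reflQuot_sub_one_mem (isUniformizer_unit_mul h2 u) E hq hE hσ₀ β)
  rw [unitBallToCBall_algebraMap_generator,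
    span_singleton_unit_mul_eq (isUnit_unitBallToCBall_algebraMap_unit u E)] at h
  exact h

/-- ★ … in J10's DIVISIBILITY currency, higher coefficients. -/
theorem two_dvd_coeff_succ_reflQuotC (β : RelNormCoherentUnits (isUniformizer_unit_mul h2 u) E) (n : ℕ) :
    (2 : CBall F) ∣ PowerSeries.coeff (n + 1) (reflQuotC hq h2 u E hE hσ₀ β) :=
  (sub_one_mem_coeffIdeal_span_iff.mp (reflQuotC_sub_one_mem hq h2 u E hE hσ₀ β)).2 n

/-- ★ … constant coefficient: `2 ∣ Q̄_β(0) − 1` (so `Q̄_β(0) = g_β(0)/g_β(ω₁')` is a principal unit, NOT `1`). -/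
theorem two_dvd_constantCoeff_reflQuotC_sub_one (β : RelNormCoherentUnits (isUniformizer_unit_mul h2 u) E) :
    (2 : CBall F) ∣ PowerSeries.constantCoeff (reflQuotC hq h2 u E hE hσ₀ β) - 1 :=
  (sub_one_mem_coeffIdeal_span_iff.mp (reflQuotC_sub_one_mem hq h2 u E hE hσ₀ β)).1

include h2 in
theorem isUnit_constantCoeff_reflQuotC (β : RelNormCoherentUnits (isUniformizer_unit_mul h2 u) E) :
    IsUnit (PowerSeries.constantCoeff (reflQuotC hq h2 u E hE hσ₀ β)) :=
  isUnit_of_norm_sub_one_lt_one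
    (norm_sub_one_lt_one_of_two_dvd (norm_two_lt_one_C h2) (two_dvd_constantCoeff_reflQuotC_sub_one hq h2 u E hE hσ₀ β))

/-- THE GAUGE UNIT `a_β := Q̄_β(0) ∈ 𝒪_ℂˣ`. -/
def gaugeUnit (β : RelNormCoherentUnits (isUniformizer_unit_mul h2 u) E) : (CBall F)ˣ :=
  (isUnit_constantCoeff_reflQuotC hq h2 u E hE hσ₀ β).unit

theorem coe_gaugeUnit (β : RelNormCoherentUnits (isUniformizer_unit_mul h2 u) E) :
    (gaugeUnit hq h2 u E hE hσ₀ β : CBall F) = PowerSeries.constantCoeff (reflQuotC hq h2 u E hE hσ₀ β) := rfl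

/-- ★ **THE NORMALISED REFLECTION QUOTIENT `P_β := a_β⁻¹ · Q̄_β ∈ 𝒪_ℂ⟦X⟧`** — J10's `P`. -/
def reflQuotN (β : RelNormCoherentUnits (isUniformizer_unit_mul h2 u) E) : PowerSeries (CBall F) :=
  PowerSeries.C ((↑(gaugeUnit hq h2 u E hE hσ₀ β)⁻¹ : CBall F)) * reflQuotC hq h2 u E hE hσ₀ β

/-- ★ J10's `hP0` for the witness. -/
theorem constantCoeff_reflQuotN (β : RelNormCoherentUnits (isUniformizer_unit_mul h2 u) E) :
    PowerSeries.constantCoeff (reflQuotN hq h2 u E hE hσ₀ β) = 1 :=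
  constantCoeff_C_inv_mul (gaugeUnit hq h2 u E hE hσ₀ β) (coe_gaugeUnit hq h2 u E hE hσ₀ β).symm

/-- ★ J10's `hP` for the witness. -/
theorem two_dvd_coeff_succ_reflQuotN (β : RelNormCoherentUnits (isUniformizer_unit_mul h2 u) E) (n : ℕ) :
    (2 : CBall F) ∣ PowerSeries.coeff (n + 1) (reflQuotN hq h2 u E hE hσ₀ β) :=
  dvd_coeff_succ_C_mul _ (two_dvd_coeff_succ_reflQuotC hq h2 u E hE hσ₀ β) n

/-! ### §D  ★★ R219-INST₂-CORE (α): the `∘ϑ̄`-line instance at `P := P_β`, junction with J10 closed in the kernel. -/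

include hθc hθ1 in
/-- ★★ **R219-INST₂-CORE (α) — THE `∘ϑ̄`-LINE INSTANCE AT THE WITNESS.**  For every relative norm-coherent unit
`β` and every point `z₀ ∈ 𝔪_ℂ` (the `σ a`-conjugate torsion point of `read₂_of_refl_cut`, read in `𝒪_ℂ`), the
reading witness `(L∘y)∘ϑ̄ ∈ 𝒪_ℂ⟦S⟧` of the NORMALISED reflection quotient `P_β` EXISTS and its `θ`-value at `z₀`,
computed as the reading computes it (`Σ_m θ([S^m]·)·θ(z₀)^m`), IS `½·plog θ(P_β(ϑ̄(z₀)))`.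
Assembly: producer §C (k3-g39's congruence ↦ J10's currency, normalised) ▸ J10 at the point `ϑ̄(z₀) ∈ 𝔪_ℂ`
▸ k3-g40's `tsum_coeff_map_subst_mul_pow_eq` (the `∘ϑ̄` line) ▸ tree `evS_subst`.  No hypothesis beyond the frame. -/
theorem inst₂_core_alpha (β : RelNormCoherentUnits (isUniformizer_unit_mul h2 u) E) (z₀ : (maxNilIdealC F).toIdeal) :
    ∃ L y : PowerSeries (CBall F), PowerSeries.constantCoeff y = 0 ∧
      reflQuotN hq h2 u E hE hσ₀ β = 1 + PowerSeries.C (2 : CBall F) * y ∧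
      θ ((PowerSeries.coeff 0 L : CBall F) : CompletedAlgClosure F) = 0 ∧
      ∑' m : ℕ, PowerSeries.coeff m (PowerSeries.map (θ.comp (CBall F).subtype)
          (PowerSeries.subst (thetaBar h2 u hσ₀ hε) (PowerSeries.subst y L))) *
          (θ ((z₀ : CBall F) : CompletedAlgClosure F)) ^ m =
        (2 : ℂ_[2])⁻¹ * PadicExp.plog
          (θ ((evS (maxNilIdealC F) z₀
            (PowerSeries.subst (thetaBar h2 u hσ₀ hε) (reflQuotN hq h2 u E hE hσ₀ β)) : CBall F) :
              CompletedAlgClosure F)) := by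
  obtain ⟨L, y, hy0, hPy, hL0, hval⟩ := CriticG42.inst₂_leaves_assembled θ hθc hθ1 (norm_two_lt_one_C h2)
    (reflQuotN hq h2 u E hE hσ₀ β) (constantCoeff_reflQuotN hq h2 u E hE hσ₀ β)
    (two_dvd_coeff_succ_reflQuotN hq h2 u E hE hσ₀ β)
    ⟨evS (maxNilIdealC F) z₀ (thetaBar h2 u hσ₀ hε),
      evS_mem_of_constantCoeff_eq_zero _ z₀ (constantCoeff_thetaBar h2 u hσ₀ hε)⟩
  refine ⟨L, y, hy0, hPy, hL0, ?_⟩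
  rw [ReadTwoCutK3G40.tsum_coeff_map_subst_mul_pow_eq θ hθc (PowerSeries.subst y L) (thetaBar h2 u hσ₀ hε)
      (constantCoeff_thetaBar h2 u hσ₀ hε) z₀,
    evS_subst (maxNilIdealC F) z₀ (constantCoeff_thetaBar h2 u hσ₀ hε)]
  exact hval

/-! ### §E  (β)-KEY: the gauge constant, and the identification with k3-g39's transport `V_β`. -/

/-- `P_β(ϑ̄(z₀)) = a_β⁻¹ · Q̄_β(ϑ̄(z₀))` in `𝒪_ℂ`. -/
theorem evS_subst_thetaBar_reflQuotN (β : RelNormCoherentUnits (isUniformizer_unit_mul h2 u) E)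
    (z₀ : (maxNilIdealC F).toIdeal) :
    evS (maxNilIdealC F) z₀ (PowerSeries.subst (thetaBar h2 u hσ₀ hε) (reflQuotN hq h2 u E hE hσ₀ β)) =
      (↑(gaugeUnit hq h2 u E hE hσ₀ β)⁻¹ : CBall F) *
        evS (maxNilIdealC F) z₀ (PowerSeries.subst (thetaBar h2 u hσ₀ hε) (reflQuotC hq h2 u E hE hσ₀ β)) := by
  rw [evS_subst (maxNilIdealC F) z₀ (constantCoeff_thetaBar h2 u hσ₀ hε),
    evS_subst (maxNilIdealC F) z₀ (constantCoeff_thetaBar h2 u hσ₀ hε), reflQuotN, map_mul, evS_C]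

/-- THE GAUGE CONSTANT of the reading: `c_β := −½·plog θ(a_β)` — INDEPENDENT of the evaluation point; it is what
`read₂_of_refl_cut`'s `c`-slot absorbs (critic (β), B67's «constant of integration invisible to χ₀ ≠ 1»). -/
def gaugeConst (β : RelNormCoherentUnits (isUniformizer_unit_mul h2 u) E) : ℂ_[2] :=
  -((2 : ℂ_[2])⁻¹ * PadicExp.plog (θ ((gaugeUnit hq h2 u E hE hσ₀ β : CBall F) : CompletedAlgClosure F)))

include hθ1 in
/-- `θ(a_β)` is a principal unit of `ℂ₂`. -/
theorem norm_one_sub_map_gaugeUnit_lt (β : RelNormCoherentUnits (isUniformizer_unit_mul h2 u) E) :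
    ‖1 - θ ((gaugeUnit hq h2 u E hE hσ₀ β : CBall F) : CompletedAlgClosure F)‖ < 1 :=
  norm_one_sub_map_lt_one_of_two_dvd θ hθ1 (two_dvd_constantCoeff_reflQuotC_sub_one hq h2 u E hE hσ₀ β)

include hθ1 in
/-- `θ(P_β(ϑ̄(z₀)))` is a principal unit of `ℂ₂`. -/
theorem norm_one_sub_map_evS_reflQuotN_lt (β : RelNormCoherentUnits (isUniformizer_unit_mul h2 u) E)
    (z₀ : (maxNilIdealC F).toIdeal) :
    ‖1 - θ ((evS (maxNilIdealC F) z₀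
      (PowerSeries.subst (thetaBar h2 u hσ₀ hε) (reflQuotN hq h2 u E hE hσ₀ β)) : CBall F) :
        CompletedAlgClosure F)‖ < 1 := by
  rw [evS_subst (maxNilIdealC F) z₀ (constantCoeff_thetaBar h2 u hσ₀ hε)]
  exact norm_one_sub_map_lt_one_of_two_dvd θ hθ1 (two_dvd_evS_sub_one
    (constantCoeff_reflQuotN hq h2 u E hE hσ₀ β) (two_dvd_coeff_succ_reflQuotN hq h2 u E hE hσ₀ β) _)

include hθ1 in
/-- ★ **(β)-KEY**: `½·plog θ(P_β(ϑ̄ z₀)) = ½·plog θ(Q̄_β(ϑ̄ z₀)) + c_β` — the normalisation costs exactly a constant.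
(`plog` is additive on principal units ONLY; both factors are principal by §B, `hθ1` alone.) -/
theorem half_plog_reflQuotN_eq (β : RelNormCoherentUnits (isUniformizer_unit_mul h2 u) E)
    (z₀ : (maxNilIdealC F).toIdeal) :
    (2 : ℂ_[2])⁻¹ * PadicExp.plog (θ ((evS (maxNilIdealC F) z₀
        (PowerSeries.subst (thetaBar h2 u hσ₀ hε) (reflQuotN hq h2 u E hE hσ₀ β)) : CBall F) :
          CompletedAlgClosure F)) =
      (2 : ℂ_[2])⁻¹ * PadicExp.plog (θ ((evS (maxNilIdealC F) z₀
        (PowerSeries.subst (thetaBar h2 u hσ₀ hε) (reflQuotC hq h2 u E hE hσ₀ β)) : CBall F) :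
          CompletedAlgClosure F)) + gaugeConst hq h2 u E hE hσ₀ θ β := by
  have hq' := norm_one_sub_map_evS_reflQuotN_lt hq h2 u E hE hσ₀ hε θ hθ1 β z₀
  have hr := norm_one_sub_map_gaugeUnit_lt hq h2 u E hE hσ₀ θ hθ1 β
  have hinv : θ (((↑(gaugeUnit hq h2 u E hE hσ₀ β)⁻¹ : CBall F)) : CompletedAlgClosure F) *
      θ ((gaugeUnit hq h2 u E hE hσ₀ β : CBall F) : CompletedAlgClosure F) = 1 := by
    rw [← map_mul, ← Subring.coe_mul, Units.inv_mul, Subring.coe_one, map_one]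
  have hmul : θ ((evS (maxNilIdealC F) z₀
        (PowerSeries.subst (thetaBar h2 u hσ₀ hε) (reflQuotN hq h2 u E hE hσ₀ β)) : CBall F) :
          CompletedAlgClosure F) *
      θ ((gaugeUnit hq h2 u E hE hσ₀ β : CBall F) : CompletedAlgClosure F) =
      θ ((evS (maxNilIdealC F) z₀
        (PowerSeries.subst (thetaBar h2 u hσ₀ hε) (reflQuotC hq h2 u E hE hσ₀ β)) : CBall F) :
          CompletedAlgClosure F) := by
    rw [evS_subst_thetaBar_reflQuotN, Subring.coe_mul, map_mul, mul_right_comm, hinv, one_mul]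
  rw [ReadTwoCutK3G40.plog_eq_sub_of_mul_eq hq' hr hmul, gaugeConst]
  ring

variable (j : unitBall E →+* UnrCoeff F) (hjC : (algebraMap (UnrCoeff F) (CBall F)).comp j = unitBallToCBall E)

include hjC in
/-- ★ **IDENTIFICATION WITH THE WITNESS OF RECORD**: `θ̄(Q̄_β ∘ ϑ̄) = transport (reflQuot β) = Θ(j(Q_β) ∘ ϑ)`
(k3-g39's `V_β`-carrier; tree `map_subst_compSeriesC_map_eq`, the only place `j`/`hjC` enter). -/
theorem map_subst_thetaBar_reflQuotC_eq_transport (β : RelNormCoherentUnits (isUniformizer_unit_mul h2 u) E) :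
    (PowerSeries.subst (thetaBar h2 u hσ₀ hε) (reflQuotC hq h2 u E hE hσ₀ β)).map (θ.comp (CBall F).subtype) =
      ReflectionPrimitiveK3G39.transport h2 u E hσ₀ j hε θ
        (ReflectionPrimitiveK3G39.reflQuot (isUniformizer_unit_mul h2 u) E hq hE hσ₀ β : PowerSeries (unitBall E)) :=
  (map_subst_compSeriesC_map_eq h2 u E hσ₀ j hε θ hjC _).symm

include hθc hjC in
/-- ★ the VALUE of the transported quotient at `z₀`, as the reading evaluates it, is `θ(Q̄_β(ϑ̄ z₀))`. -/
theorem transport_reflQuot_value (β : RelNormCoherentUnits (isUniformizer_unit_mul h2 u) E)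
    (z₀ : (maxNilIdealC F).toIdeal) :
    ∑' m : ℕ, PowerSeries.coeff m (ReflectionPrimitiveK3G39.transport h2 u E hσ₀ j hε θ
        (ReflectionPrimitiveK3G39.reflQuot (isUniformizer_unit_mul h2 u) E hq hE hσ₀ β : PowerSeries (unitBall E))) *
        (θ ((z₀ : CBall F) : CompletedAlgClosure F)) ^ m =
      θ ((evS (maxNilIdealC F) z₀
        (PowerSeries.subst (thetaBar h2 u hσ₀ hε) (reflQuotC hq h2 u E hE hσ₀ β)) : CBall F) :
          CompletedAlgClosure F) := by
  rw [← map_subst_thetaBar_reflQuotC_eq_transport hq h2 u E hE hσ₀ hε θ j hjC]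
  exact (hasSum_map_coeff_mul_pow θ hθc _ z₀).tsum_eq

include hθc hθ1 hjC in
/-- ★★ **(α) + (β)-KEY COMBINED, in the shape the reading consumes**: the reading witness of `P_β` along `ϑ̄`
evaluates at `z₀` to `½·plog (V_β-value at z₀) + c_β`, where the `V_β`-value is the evaluated TRANSPORT of record
and `c_β` does not depend on `z₀` (so it lands in `read₂_of_refl_cut`'s `c`). -/
theorem inst₂_core_alpha_beta (β : RelNormCoherentUnits (isUniformizer_unit_mul h2 u) E)
    (z₀ : (maxNilIdealC F).toIdeal) :
    ∃ L y : PowerSeries (CBall F), PowerSeries.constantCoeff y = 0 ∧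
      reflQuotN hq h2 u E hE hσ₀ β = 1 + PowerSeries.C (2 : CBall F) * y ∧
      θ ((PowerSeries.coeff 0 L : CBall F) : CompletedAlgClosure F) = 0 ∧
      ∑' m : ℕ, PowerSeries.coeff m (PowerSeries.map (θ.comp (CBall F).subtype)
          (PowerSeries.subst (thetaBar h2 u hσ₀ hε) (PowerSeries.subst y L))) *
          (θ ((z₀ : CBall F) : CompletedAlgClosure F)) ^ m =
        (2 : ℂ_[2])⁻¹ * PadicExp.plog
          (∑' m : ℕ, PowerSeries.coeff m (ReflectionPrimitiveK3G39.transport h2 u E hσ₀ j hε θ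
            (ReflectionPrimitiveK3G39.reflQuot (isUniformizer_unit_mul h2 u) E hq hE hσ₀ β :
              PowerSeries (unitBall E))) * (θ ((z₀ : CBall F) : CompletedAlgClosure F)) ^ m) +
          gaugeConst hq h2 u E hE hσ₀ θ β := by
  obtain ⟨L, y, hy0, hPy, hL0, hval⟩ := inst₂_core_alpha hq h2 u E hE hσ₀ hε θ hθc hθ1 β z₀
  refine ⟨L, y, hy0, hPy, hL0, ?_⟩
  rw [hval, half_plog_reflQuotN_eq hq h2 u E hE hσ₀ hε θ hθ1 β z₀,
    transport_reflQuot_value hq h2 u E hE hσ₀ hε θ hθc j hjC β z₀]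

/-! ### §F  The LOG-BRANCH remark for (β)/(δ) (new observation) and the quotient identity it needs. -/

/-- `Q_β · τ_E g_β = g_β` (units of `𝒪_E⟦X⟧`, k3-g39's definition unfolded). -/
theorem reflQuot_mul_reflE (β : RelNormCoherentUnits (isUniformizer_unit_mul h2 u) E) :
    (ReflectionPrimitiveK3G39.reflQuot (isUniformizer_unit_mul h2 u) E hq hE hσ₀ β : PowerSeries (unitBall E)) *
        reflE (isUniformizer_unit_mul h2 u) E
          (ReflectionPrimitiveK3G39.gUnit (isUniformizer_unit_mul h2 u) E hq hE hσ₀ β : PowerSeries (unitBall E)) =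
      (ReflectionPrimitiveK3G39.gUnit (isUniformizer_unit_mul h2 u) E hq hE hσ₀ β : PowerSeries (unitBall E)) := by
  have h := congrArg Units.val (inv_mul_cancel_right
    (ReflectionPrimitiveK3G39.gUnit (isUniformizer_unit_mul h2 u) E hq hE hσ₀ β)
    (reflEUnit (isUniformizer_unit_mul h2 u) E
      (ReflectionPrimitiveK3G39.gUnit (isUniformizer_unit_mul h2 u) E hq hE hσ₀ β)))
  rw [Units.val_mul, coe_reflEUnit] at h
  exact h

/-- `τ_E` is `𝒪_E`-linear on constants: `τ_E (C a · G) = C a · τ_E G`. -/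
theorem reflE_C_mul (a : unitBall E) (G : PowerSeries (unitBall E)) :
    reflE (isUniformizer_unit_mul h2 u) E (PowerSeries.C a * G) =
      PowerSeries.C a * reflE (isUniformizer_unit_mul h2 u) E G := by
  rw [map_mul, reflE_C]

/-- ★ **LOG-BRANCH REMARK (β′)**: the reflection quotient is GAUGE-INVARIANT under `g ↦ C a · g` — so in the REFL
presentation `plog Q̄_β(w) = Lg a − Lg (a+s)` one may (and must) take `Lg` on the PRINCIPAL normalisation
`g_β/g_β(0)` (`g_β(w_a)` itself is a unit of `𝒪_ℂ` but NOT a principal unit when `[k_E : 𝔽₂] > 1`, and `plog` of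
record is the principal branch). -/
theorem quot_mul_reflE_rescale {Q G : PowerSeries (unitBall E)}
    (h : Q * reflE (isUniformizer_unit_mul h2 u) E G = G) (a : unitBall E) :
    Q * reflE (isUniformizer_unit_mul h2 u) E (PowerSeries.C a * G) = PowerSeries.C a * G := by
  rw [reflE_C_mul h2 u, mul_left_comm, h]

end Witness

end Summit.BirchSwinnertonDyer.BirchSwinnertonDyer.Cruxes.SplitBadTwoLowerHalfOfFacts.InstCoreK1G41

/-! ### PART V6 — VERBATIM from critic g41 `critic_k3g40_K3_reflsum.lean` (sha16 `c85c8fc2ad323e66`), ll. 16–81: `refl_table_charSum`, `mulChar_eq_neg_one_of_sq` (credit: stub-critic g41; B74 copy). -/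

namespace Summit.BirchSwinnertonDyer.BirchSwinnertonDyer.Cruxes.SplitBadTwoLowerHalfOfFacts.CriticG41

/-- ★ **REFL TABLE CHARACTER SUM.**  `Γ` a finite group, `e : Γ ≃* (ℤ/N)ˣ`, `ψ` a multiplicative character with
`ψ(e γ₀) = −1` for an element `γ₀` of order dividing two: the `ψ`-sum of the reflected table `κ(Tγ − T(γγ₀))` is
`2κ` times the `ψ`-sum of `T`. (Apply with `ψ = χ⁻¹`, `γ₀ ↔ 1 + 2^n`, `κ = (2Θε)⁻¹`.) -/
theorem refl_table_charSum {R' : Type*} [CommRing R'] {N : ℕ} [NeZero N] {Γ : Type*} [Group Γ] [Fintype Γ]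
    (e : Γ ≃* (ZMod N)ˣ) (ψ : MulChar (ZMod N) R') (T : Γ → R') (κ : R') (γ₀ : Γ)
    (hγ₀ : γ₀ * γ₀ = 1) (hψ : ψ ((e γ₀ : (ZMod N)ˣ) : ZMod N) = -1) :
    ∑ γ : Γ, ψ ((e γ : (ZMod N)ˣ) : ZMod N) * (κ * (T γ - T (γ * γ₀))) =
      2 * κ * ∑ γ : Γ, ψ ((e γ : (ZMod N)ˣ) : ZMod N) * T γ := by
  -- reindex the shifted sum by `γ ↦ γ·γ₀` (an involution since `γ₀² = 1`)
  have hre : ∑ γ : Γ, ψ ((e γ : (ZMod N)ˣ) : ZMod N) * T (γ * γ₀) =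
      ∑ δ : Γ, ψ ((e (δ * γ₀) : (ZMod N)ˣ) : ZMod N) * T δ := by
    refine (Fintype.sum_equiv (Equiv.mulRight γ₀)
      (fun δ => ψ ((e (δ * γ₀) : (ZMod N)ˣ) : ZMod N) * T δ)
      (fun γ => ψ ((e γ : (ZMod N)ˣ) : ZMod N) * T (γ * γ₀)) (fun δ => ?_)).symm
    simp only [Equiv.coe_mulRight, mul_assoc, hγ₀, mul_one]
  have hneg : ∀ δ : Γ, ψ ((e (δ * γ₀) : (ZMod N)ˣ) : ZMod N) = -ψ ((e δ : (ZMod N)ˣ) : ZMod N) := by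
    intro δ
    rw [map_mul, Units.val_mul, map_mul, hψ, mul_neg, mul_one]
  have hsplit : ∀ γ : Γ, ψ ((e γ : (ZMod N)ˣ) : ZMod N) * (κ * (T γ - T (γ * γ₀))) =
      κ * (ψ ((e γ : (ZMod N)ˣ) : ZMod N) * T γ) - κ * (ψ ((e γ : (ZMod N)ˣ) : ZMod N) * T (γ * γ₀)) := by
    intro γ; ring
  simp_rw [hsplit]
  rw [Finset.sum_sub_distrib, ← Finset.mul_sum, ← Finset.mul_sum, hre]
  simp_rw [hneg, neg_mul, Finset.sum_neg_distrib]
  ring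

/-- With k3-g38's `atom_shape` output `χ⁻¹(−1)·Σ_γ χ⁻¹(eγ)·ℓ γ` and `ℓ = κ(T − T(·γ₀))`: the Gauss-side sum equals
the FROB-normalised `χ⁻¹(−1)·(2κ)·Σ_γ χ⁻¹(eγ)·T γ`. -/
theorem atom_output_refl_eq_frob {R' : Type*} [CommRing R'] {N : ℕ} [NeZero N] {Γ : Type*} [Group Γ] [Fintype Γ]
    (e : Γ ≃* (ZMod N)ˣ) (χinv : MulChar (ZMod N) R') (T : Γ → R') (κ c₁ : R') (γ₀ : Γ)
    (hγ₀ : γ₀ * γ₀ = 1) (hχ : χinv ((e γ₀ : (ZMod N)ˣ) : ZMod N) = -1) :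
    c₁ * ∑ γ : Γ, χinv ((e γ : (ZMod N)ˣ) : ZMod N) * (κ * (T γ - T (γ * γ₀))) =
      c₁ * (2 * κ) * ∑ γ : Γ, χinv ((e γ : (ZMod N)ˣ) : ZMod N) * T γ := by
  rw [refl_table_charSum e χinv T κ γ₀ hγ₀ hχ]
  ring

/-! ### The shift element at levels `n = 1, 2` (`N = 4, 8`, `M = 2, 4`): `γ₀ = 1 + 2^n` has square `1` and is the
only non-trivial unit `≡ 1 (mod 2^n)` — so a character not factoring through `ℤ/2^n` takes the value `−1` on it
(`χ(γ₀)² = 1`, `χ(γ₀) ≠ 1`, domain). -/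

example : ((1 + 2 : ZMod 4)) ^ 2 = 1 := by decide
example : ((1 + 4 : ZMod 8)) ^ 2 = 1 := by decide
example : ∀ u : ZMod 8, IsUnit u → ZMod.castHom (show 4 ∣ 8 by norm_num) (ZMod 4) u = 1 → u = 1 ∨ u = 5 := by
  decide
example : ∀ u : ZMod 4, IsUnit u → ZMod.castHom (show 2 ∣ 4 by norm_num) (ZMod 2) u = 1 → u = 1 ∨ u = 3 := by
  decide

/-- In a domain, a value with square one that is not one is minus one (the step `χ(γ₀)² = χ(γ₀²) = 1 ⟹ χ(γ₀) = −1`). -/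
theorem eq_neg_one_of_sq_eq_one {R' : Type*} [CommRing R'] [IsDomain R'] {x : R'} (hx : x ^ 2 = 1) (h1 : x ≠ 1) :
    x = -1 := by
  have h : (x - 1) * (x + 1) = 0 := by ring_nf; rw [hx]; ring
  rcases mul_eq_zero.mp h with h | h
  · exact absurd (sub_eq_zero.mp h) h1
  · exact eq_neg_of_add_eq_zero_left h

/-- ★ `χ(γ₀) = −1` for every character non-trivial on an element of order dividing two (domain coefficients) —
the hypothesis `hχu : χ u ≠ 1` of k3-g38's `atom_shape` with `u = 1 + 2^n`. -/
theorem mulChar_eq_neg_one_of_sq {R' : Type*} [CommRing R'] [IsDomain R'] {N : ℕ} [NeZero N]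
    (χ : MulChar (ZMod N) R') (u : (ZMod N)ˣ) (hu : u * u = 1) (hχu : χ (u : ZMod N) ≠ 1) :
    χ (u : ZMod N) = -1 := by
  refine eq_neg_one_of_sq_eq_one ?_ hχu
  rw [sq, ← map_mul, ← Units.val_mul, hu, Units.val_one, map_one]

end Summit.BirchSwinnertonDyer.BirchSwinnertonDyer.Cruxes.SplitBadTwoLowerHalfOfFacts.CriticG41

/-! ### PART V7 — VERBATIM from k3-g40 `STUB_IDEAS_stub_heegnerIndexLowerAtTwo_3_g40.lean` (sha16 `2333f3139e2b61f4`),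
§4 (ll. 363–495): `coeff_map_iterate`, `ActsAsFrobPow`, `evS_mapPt_eq_of_actsAsFrobPow` (PROVED there), the typed
sub-stub `LocalUntwistExists`, `exists_untwisted_table` — token-identical, same namespace (credit: k3-g40; B74 copy;
used ONLY by PART M §E). -/

namespace Summit.BirchSwinnertonDyer.BirchSwinnertonDyer.Cruxes.SplitBadTwoLowerHalfOfFacts.ReadTwoCutK3G40

/-! ## §4. S2 = R217 LOCAL-UNTWIST₂ in the tree's RELATIVE currency (`exists_relColeman`):
the VALUE half is semilinearity (PROVED); the EXISTENCE half is the typed sub-stub `LocalUntwistExists`. -/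

section LocalUntwist

open ValuativeRel IsLocalRing Field
open Literature.NumberTheory.GaloisRepresentations Literature.NumberTheory.GaloisRepresentations.IsNonarchimedeanLocalField
  Literature.NumberTheory.GaloisRepresentations.LubinTate Literature.NumberTheory.PAdicHodge

variable {F : Type} [Field F] [ValuativeRel F] [TopologicalSpace F] [IsNonarchimedeanLocalField F]

attribute [local instance] ltNormUniformSpace ltNormIsUniformAddGroup rk1 nF nE fintypeResidueField

variable {π : 𝒪[F]} (hπ : (valuation F).IsUniformizer (π : F))
variable (E : IntermediateField F (AlgebraicClosure F)) [FiniteDimensional F E] [Normal F E]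

/-- Coefficients of an iterated coefficient map. -/
theorem coeff_map_iterate {A : Type*} [CommSemiring A] (ψ : A →+* A) (k : ℕ) (g : PowerSeries A) (n : ℕ) :
    PowerSeries.coeff n ((PowerSeries.map ψ)^[k] g) = ψ^[k] (PowerSeries.coeff n g) := by
  induction k generalizing g with
  | zero => rfl
  | succ k ih => rw [Function.iterate_succ_apply, ih, PowerSeries.coeff_map, ← Function.iterate_succ_apply ψ]

/-- "`τ ∈ Aut_F(E·K_π^{m+1})` acts on `𝒪_E` as `φ^K`" (`φ = frobUnitBall E σ₀`; `K` is NOT tied to the level). -/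
def ActsAsFrobPow (σ₀ : absoluteGaloisGroup F) (K : ℕ) {m : ℕ}
    (τ : (E ⊔ ltField π m : IntermediateField F (AlgebraicClosure F)) ≃ₐ[F]
      (E ⊔ ltField π m : IntermediateField F (AlgebraicClosure F))) : Prop :=
  ∀ x : unitBall E, τ (IntermediateField.inclusion le_sup_left (x : E)) =
    IntermediateField.inclusion le_sup_left
      (((((frobUnitBall E σ₀ : unitBall E ≃+* unitBall E) : unitBall E →+* unitBall E) :
        unitBall E → unitBall E)^[K] x : unitBall E) : E)

/-- ★ **S2, VALUE HALF (PROVED): the local untwist is semilinearity — for EVERY Frobenius offset `k`.**  If `g`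
interpolates `β` in the sense of `exists_relColeman` (`((φ⁻¹)^{m+1} g)^ι(ι ω_{m+1}) = β_m`) and `τ` acts on `𝒪_E` as
`φ^{m+1+k}`, then `(φ^k g)^ι(τ(ι ω_{m+1})) = τ(β_m)`: `k = 0` reads the level-`n+1` table of `g_b` itself (`Lg`),
`k = 1` the level-`n` table of `g_b^φ` (`Lφ`, the `½`-term of `log̃`), as Galois conjugates of table entries. -/
theorem evS_mapPt_eq_of_actsAsFrobPow (σ₀ : absoluteGaloisGroup F) (g : PowerSeries (unitBall E)) (m k : ℕ)
    (β : unitBall (E ⊔ ltField π m : IntermediateField F (AlgebraicClosure F)))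
    (hg : evS (maxNilIdeal F (E ⊔ ltField π m : IntermediateField F (AlgebraicClosure F)))
        (inclPt (le_sup_right : ltField π m ≤ E ⊔ ltField π m) (cohPt hπ m))
        (PowerSeries.map (inclUnitBall (F := F) (le_sup_left : E ≤ E ⊔ ltField π m) :
          unitBall E →+* unitBall (E ⊔ ltField π m : IntermediateField F (AlgebraicClosure F)))
          ((PowerSeries.map ((frobUnitBall E σ₀).symm : unitBall E →+* unitBall E))^[m + 1] g)) = β)
    (τ : (E ⊔ ltField π m : IntermediateField F (AlgebraicClosure F)) ≃ₐ[F]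
      (E ⊔ ltField π m : IntermediateField F (AlgebraicClosure F)))
    (hτ : ActsAsFrobPow E σ₀ (m + 1 + k) τ) :
    ((evS (maxNilIdeal F (E ⊔ ltField π m : IntermediateField F (AlgebraicClosure F)))
        (mapPt τ (inclPt (le_sup_right : ltField π m ≤ E ⊔ ltField π m) (cohPt hπ m)))
        (PowerSeries.map (inclUnitBall (F := F) (le_sup_left : E ≤ E ⊔ ltField π m) :
          unitBall E →+* unitBall (E ⊔ ltField π m : IntermediateField F (AlgebraicClosure F)))
          ((PowerSeries.map (frobUnitBall E σ₀ : unitBall E →+* unitBall E))^[k] g)) :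
        unitBall (E ⊔ ltField π m : IntermediateField F (AlgebraicClosure F))) :
        (E ⊔ ltField π m : IntermediateField F (AlgebraicClosure F))) =
      τ ((β : unitBall (E ⊔ ltField π m : IntermediateField F (AlgebraicClosure F))) :
        (E ⊔ ltField π m : IntermediateField F (AlgebraicClosure F))) := by
  -- the coefficient computation: `τ ∘ ι ∘ (φ⁻¹)^{m+1} = ι ∘ φ^k` on the coefficients of `g`
  have hfix : PowerSeries.map (toUnitBallHom τ : unitBall (E ⊔ ltField π m : IntermediateField F (AlgebraicClosure F)) →+*
        unitBall (E ⊔ ltField π m : IntermediateField F (AlgebraicClosure F)))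
      (PowerSeries.map (inclUnitBall (F := F) (le_sup_left : E ≤ E ⊔ ltField π m) :
          unitBall E →+* unitBall (E ⊔ ltField π m : IntermediateField F (AlgebraicClosure F)))
        ((PowerSeries.map ((frobUnitBall E σ₀).symm : unitBall E →+* unitBall E))^[m + 1] g)) =
      PowerSeries.map (inclUnitBall (F := F) (le_sup_left : E ≤ E ⊔ ltField π m) :
          unitBall E →+* unitBall (E ⊔ ltField π m : IntermediateField F (AlgebraicClosure F)))
        ((PowerSeries.map (frobUnitBall E σ₀ : unitBall E →+* unitBall E))^[k] g) := by
    refine PowerSeries.ext fun n => ?_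
    rw [PowerSeries.coeff_map, PowerSeries.coeff_map, PowerSeries.coeff_map, coeff_map_iterate, coeff_map_iterate]
    refine Subtype.ext ?_
    have hcancel : ∀ c : unitBall E,
        (((frobUnitBall E σ₀ : unitBall E ≃+* unitBall E) : unitBall E →+* unitBall E) :
            unitBall E → unitBall E)^[m + 1]
          (((((frobUnitBall E σ₀).symm : unitBall E ≃+* unitBall E) : unitBall E →+* unitBall E) :
            unitBall E → unitBall E)^[m + 1] c) = c :=
      Function.LeftInverse.iterate
        (g := (((frobUnitBall E σ₀ : unitBall E ≃+* unitBall E) : unitBall E →+* unitBall E) :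
            unitBall E → unitBall E))
        (f := ((((frobUnitBall E σ₀).symm : unitBall E ≃+* unitBall E) : unitBall E →+* unitBall E) :
            unitBall E → unitBall E))
        (fun x => by simpa using (frobUnitBall E σ₀).apply_symm_apply x) (m + 1)
    have h1 := hτ (((((frobUnitBall E σ₀).symm : unitBall E ≃+* unitBall E) : unitBall E →+* unitBall E) :
            unitBall E → unitBall E)^[m + 1] (PowerSeries.coeff n g))
    rw [show m + 1 + k = k + (m + 1) from Nat.add_comm _ _] at h1
    rw [Function.iterate_add_apply _ k (m + 1), hcancel] at h1
    exact h1
  have key := algEquiv_evS (E ⊔ ltField π m : IntermediateField F (AlgebraicClosure F)) τ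
    (PowerSeries.map (inclUnitBall (F := F) (le_sup_left : E ≤ E ⊔ ltField π m) :
        unitBall E →+* unitBall (E ⊔ ltField π m : IntermediateField F (AlgebraicClosure F)))
      ((PowerSeries.map ((frobUnitBall E σ₀).symm : unitBall E →+* unitBall E))^[m + 1] g))
    (inclPt (le_sup_right : ltField π m ≤ E ⊔ ltField π m) (cohPt hπ m))
  rw [hfix, hg] at key
  rw [← key, coe_toUnitBallHom]

/-- **S2, EXISTENCE HALF = the typed sub-stub `LocalUntwistExists` (R217; XS–S, pure Galois bookkeeping):** for every
level `m`, Frobenius exponent `K` and unit `v ∈ 𝒪_F^×` there is `τ ∈ Aut_F(E·K_π^{m+1})` acting on `𝒪_E` as `φ^K` and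
moving `ι ω_{m+1}` exactly as `σ_v = relGalOfUnit v` does (`σ_v` fixes `E` and multiplies the torsion by `v`,
`mapPt_relGalOfUnit_relAct`).  Expected proof: `τ := relRestrict (σ₀^K · σ')` with `σ'` from
`exists_absGal_fixing_smul_ltRoot_eq` for the unit `v · χ_π(σ₀)^{-K}` (`E/F` unramified and `K_π^{m+1}/F` totally
ramified are linearly disjoint: `Gal(E·K_π^{m+1}/F) = Gal(E/F) × Gal(K_π^{m+1}/F)`). -/
def LocalUntwistExists (hE : E ≤ maxUnramified F) (σ₀ : absoluteGaloisGroup F) : Prop :=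
  ∀ (m K : ℕ) (v : 𝒪[F]ˣ), ∃ τ : (E ⊔ ltField π m : IntermediateField F (AlgebraicClosure F)) ≃ₐ[F]
      (E ⊔ ltField π m : IntermediateField F (AlgebraicClosure F)),
    ActsAsFrobPow E σ₀ K τ ∧
      mapPt τ (inclPt (le_sup_right : ltField π m ≤ E ⊔ ltField π m) (cohPt hπ m)) =
        mapPt (relGalOfUnit hπ E m hE v) (inclPt (le_sup_right : ltField π m ≤ E ⊔ ltField π m) (cohPt hπ m))

/-- ★ **S2 assembled: the UNTWISTED VALUE TABLES.**  Under `LocalUntwistExists`, for every unit `v` and offset `k` the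
value of `φ^k g` at the primitive point `σ_v(ι ω_{m+1})` is a Galois conjugate `τ(β_m)` with `τ|_{𝒪_E} = φ^{m+1+k}` —
the tables `Lg` (`k = 0`, level `n+1`) and `Lφ` (`k = 1`, level `n`) of §1, whose `plog ∘ θ` the seam
(`LogDerivSeam`, k3-g38; RCF) turns into `log σ_γ(b)`-tables. -/
theorem exists_untwisted_table (hE : E ≤ maxUnramified F) (σ₀ : absoluteGaloisGroup F)
    (hex : LocalUntwistExists hπ E hE σ₀) (g : PowerSeries (unitBall E)) (m k : ℕ)
    (β : unitBall (E ⊔ ltField π m : IntermediateField F (AlgebraicClosure F)))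
    (hg : evS (maxNilIdeal F (E ⊔ ltField π m : IntermediateField F (AlgebraicClosure F)))
        (inclPt (le_sup_right : ltField π m ≤ E ⊔ ltField π m) (cohPt hπ m))
        (PowerSeries.map (inclUnitBall (F := F) (le_sup_left : E ≤ E ⊔ ltField π m) :
          unitBall E →+* unitBall (E ⊔ ltField π m : IntermediateField F (AlgebraicClosure F)))
          ((PowerSeries.map ((frobUnitBall E σ₀).symm : unitBall E →+* unitBall E))^[m + 1] g)) = β)
    (v : 𝒪[F]ˣ) :
    ∃ τ : (E ⊔ ltField π m : IntermediateField F (AlgebraicClosure F)) ≃ₐ[F]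
        (E ⊔ ltField π m : IntermediateField F (AlgebraicClosure F)),
      ActsAsFrobPow E σ₀ (m + 1 + k) τ ∧
      ((evS (maxNilIdeal F (E ⊔ ltField π m : IntermediateField F (AlgebraicClosure F)))
          (mapPt (relGalOfUnit hπ E m hE v) (inclPt (le_sup_right : ltField π m ≤ E ⊔ ltField π m) (cohPt hπ m)))
          (PowerSeries.map (inclUnitBall (F := F) (le_sup_left : E ≤ E ⊔ ltField π m) :
            unitBall E →+* unitBall (E ⊔ ltField π m : IntermediateField F (AlgebraicClosure F)))
            ((PowerSeries.map (frobUnitBall E σ₀ : unitBall E →+* unitBall E))^[k] g)) :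
          unitBall (E ⊔ ltField π m : IntermediateField F (AlgebraicClosure F))) :
          (E ⊔ ltField π m : IntermediateField F (AlgebraicClosure F))) =
        τ ((β : unitBall (E ⊔ ltField π m : IntermediateField F (AlgebraicClosure F))) :
          (E ⊔ ltField π m : IntermediateField F (AlgebraicClosure F))) := by
  obtain ⟨τ, hτ, hpt⟩ := hex m (m + 1 + k) v
  exact ⟨τ, hτ, by rw [← hpt]; exact evS_mapPt_eq_of_actsAsFrobPow hπ E σ₀ g m k β hg τ hτ⟩

end LocalUntwist

end Summit.BirchSwinnertonDyer.BirchSwinnertonDyer.Cruxes.SplitBadTwoLowerHalfOfFacts.ReadTwoCutK3G40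

/-! ## PART M — NEW (k1-g43): «THE SEAM MODULO LEVEL n» — the weakest sufficient (= necessary) form of
R219-INST₂-CORE (γ′) ⊕ (δ), and (δ) CLOSED IN KERNEL up to that seam.  BSD / the stub / the crux are NOT proved. -/

namespace Summit.BirchSwinnertonDyer.BirchSwinnertonDyer.Cruxes.SplitBadTwoLowerHalfOfFacts.WeakSeamK1G43

/-! ### §A  Glue algebra (Mathlib-only, PROVED).  READ₂'s REFL conclusion is ONE identity per unit class; the seam
`hS2` of `read₂_of_refl_cut` is needed only as a DIFFERENCE identity, i.e. modulo `γ₀`-periodic tables; conversely the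
unit identity forces the difference seam (so this is the weakest sufficient AND the strongest necessary form). -/
section Glue

open ReadTwoCutK3G40 (RamifiedReading UnitReading ramifiedReading_of_unitReading unitReading_of_ramifiedReading)

variable {R' : Type*} [CommRing R'] {N : ℕ} [NeZero N]

/-- A1. With `V₁ = V − c`, `V₂ = −c` (the REFL presentation of record) `RamifiedReading` IS the unit identity
`V(eγ) − c = ℓ γ` — conjunct 1 is an algebraic tautology. -/
theorem ramifiedReading_const_iff {M : ℕ} (hMN : M ∣ N) {Γ : Type*} (e : Γ ≃ (ZMod N)ˣ)
    (V : ZMod N → R') (c : R') (ℓ : Γ → R') :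
    RamifiedReading hMN V (fun j : ZMod N => V j + -c) (fun _ : ZMod M => -c) e ℓ ↔
      ∀ γ : Γ, V (e γ : ZMod N) + -c = ℓ γ :=
  ⟨fun h γ => h.2 γ, fun h => ⟨fun j => show V j = V j + -c - -c by ring, h⟩⟩

/-- A2 ★ **THE WEAKEST SUFFICIENT FORM of (γ′) ⊕ (δ)**: READ₂ (REFL shape) from ONE identity per unit class,
split as (δ) `V(eγ) = κ·D γ + c` (the reading value is `κ` times SOME difference datum `D` plus the gauge constant)
and (γ′) `D γ = T γ − T(γ·γ₀)` (the datum is the `γ₀`-difference of the table `T`).  No `Lg`, no shift `s`, no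
hypothesis off the units. -/
theorem read₂_of_unit_identity {M : ℕ} (hMN : M ∣ N) {Γ : Type*} [Mul Γ] (e : Γ ≃ (ZMod N)ˣ)
    (V : ZMod N → R') (D T : Γ → R') (κ c : R') (γ₀ : Γ)
    (hS1 : ∀ γ : Γ, V (e γ : ZMod N) = κ * D γ + c)
    (hS2 : ∀ γ : Γ, D γ = T γ - T (γ * γ₀)) :
    RamifiedReading hMN V (fun j : ZMod N => V j + -c) (fun _ : ZMod M => -c) e
      (fun γ => κ * (T γ - T (γ * γ₀))) :=
  (ramifiedReading_const_iff hMN e V c _).mpr fun γ => by rw [hS1, hS2]; ring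

/-- A3 ★ **DIFFERENCE SEAM**: k3-g40's `read₂_of_refl_cut` with (i) `hS1` asked ON UNITS ONLY and (ii) the seam
`hS2` weakened to the `γ₀`-DIFFERENCE identity `Lg(eγ) − Lg(e(γγ₀)) = T γ − T(γγ₀)`. -/
theorem read₂_of_refl_cut_of_diffSeam {M : ℕ} (hMN : M ∣ N) {Γ : Type*} [Mul Γ] (e : Γ ≃ (ZMod N)ˣ)
    (V Lg : ZMod N → R') (T : Γ → R') (κ c : R') (s : ZMod N) (γ₀ : Γ)
    (hshift : ∀ γ : Γ, ((e (γ * γ₀) : (ZMod N)ˣ) : ZMod N) = (e γ : ZMod N) + s)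
    (hS1 : ∀ γ : Γ, V (e γ : ZMod N) = κ * (Lg (e γ : ZMod N) - Lg ((e γ : ZMod N) + s)) + c)
    (hS2 : ∀ γ : Γ, Lg (e γ : ZMod N) - Lg (e (γ * γ₀) : ZMod N) = T γ - T (γ * γ₀)) :
    RamifiedReading hMN V (fun j : ZMod N => V j + -c) (fun _ : ZMod M => -c) e
      (fun γ => κ * (T γ - T (γ * γ₀))) :=
  read₂_of_unit_identity hMN e V (fun γ => Lg (e γ : ZMod N) - Lg (e (γ * γ₀) : ZMod N)) T κ c γ₀
    (fun γ => by rw [hS1, ← hshift]) hS2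

/-- A4 ★★ **THE SEAM MODULO `γ₀`-PERIODIC TABLES** (the form (γ′) actually has to deliver): `Lg(eγ) = T γ + C γ` with
ANY `γ₀`-periodic correction `C` (`C(γγ₀) = C γ`) gives the SAME `RamifiedReading` as the exact seam. With
`γ₀ = 1 + 2^n` (§B) the periodic tables are exactly the tables pulled back from `(ℤ/2^n)ˣ` — additive constants,
per-level constants, anything normalised at level `n`. -/
theorem read₂_of_refl_cut_of_seam_mod_periodic {M : ℕ} (hMN : M ∣ N) {Γ : Type*} [Mul Γ] (e : Γ ≃ (ZMod N)ˣ)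
    (V Lg : ZMod N → R') (T : Γ → R') (κ c : R') (s : ZMod N) (γ₀ : Γ) (C : Γ → R')
    (hC : ∀ γ : Γ, C (γ * γ₀) = C γ)
    (hshift : ∀ γ : Γ, ((e (γ * γ₀) : (ZMod N)ˣ) : ZMod N) = (e γ : ZMod N) + s)
    (hS1 : ∀ γ : Γ, V (e γ : ZMod N) = κ * (Lg (e γ : ZMod N) - Lg ((e γ : ZMod N) + s)) + c)
    (hS2 : ∀ γ : Γ, Lg (e γ : ZMod N) = T γ + C γ) :
    RamifiedReading hMN V (fun j : ZMod N => V j + -c) (fun _ : ZMod M => -c) e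
      (fun γ => κ * (T γ - T (γ * γ₀))) :=
  read₂_of_refl_cut_of_diffSeam hMN e V Lg T κ c s γ₀ hshift hS1 fun γ => by rw [hS2, hS2, hC]; ring

/-- A5. k3-g40's `read₂_of_refl_cut` is the special case `C = 0`, `hS1` everywhere (sanity: nothing lost). -/
theorem read₂_of_refl_cut' {M : ℕ} (hMN : M ∣ N) {Γ : Type*} [Mul Γ] (e : Γ ≃ (ZMod N)ˣ)
    (V Lg : ZMod N → R') (T : Γ → R') (κ c : R') (s : ZMod N) (γ₀ : Γ)
    (hshift : ∀ γ : Γ, ((e (γ * γ₀) : (ZMod N)ˣ) : ZMod N) = (e γ : ZMod N) + s)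
    (hS1 : ∀ a : ZMod N, V a = κ * (Lg a - Lg (a + s)) + c)
    (hS2 : ∀ γ : Γ, Lg (e γ : ZMod N) = T γ) :
    RamifiedReading hMN V (fun j : ZMod N => V j + -c) (fun _ : ZMod M => -c) e
      (fun γ => κ * (T γ - T (γ * γ₀))) :=
  read₂_of_refl_cut_of_diffSeam hMN e V Lg T κ c s γ₀ hshift (fun γ => hS1 _) fun γ => by rw [hS2, hS2]

/-- A6 ★ **NECESSITY** (strongest necessary = weakest sufficient): if `κ` is cancellable, the REFL reading with table
`κ·(T γ − T(γγ₀))` FORCES the difference seam.  So (γ′) cannot be weakened below A3/A4. -/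
theorem diffSeam_of_read₂ {M : ℕ} (hMN : M ∣ N) {Γ : Type*} [Mul Γ] (e : Γ ≃ (ZMod N)ˣ)
    (V Lg : ZMod N → R') (T : Γ → R') {κ : R'} (hκ : IsUnit κ) (c : R') (s : ZMod N) (γ₀ : Γ)
    (hshift : ∀ γ : Γ, ((e (γ * γ₀) : (ZMod N)ˣ) : ZMod N) = (e γ : ZMod N) + s)
    (hS1 : ∀ γ : Γ, V (e γ : ZMod N) = κ * (Lg (e γ : ZMod N) - Lg ((e γ : ZMod N) + s)) + c)
    (h : RamifiedReading hMN V (fun j : ZMod N => V j + -c) (fun _ : ZMod M => -c) e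
      (fun γ => κ * (T γ - T (γ * γ₀)))) :
    ∀ γ : Γ, Lg (e γ : ZMod N) - Lg (e (γ * γ₀) : ZMod N) = T γ - T (γ * γ₀) := by
  intro γ
  have h1 : V (e γ : ZMod N) + -c = κ * (T γ - T (γ * γ₀)) := h.2 γ
  rw [hS1, ← hshift] at h1
  exact hκ.mul_left_cancel (by linear_combination h1)

/-- A7. The REFL table sees `T` only modulo `γ₀`-periodic tables … -/
theorem reflTable_add_periodic {Γ : Type*} [Mul Γ] (T C : Γ → R') (κ : R') (γ₀ : Γ)
    (hC : ∀ γ : Γ, C (γ * γ₀) = C γ) :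
    (fun γ => κ * ((T γ + C γ) - (T (γ * γ₀) + C (γ * γ₀)))) = fun γ => κ * (T γ - T (γ * γ₀)) := by
  funext γ; rw [hC]; ring

/-- A7′ … and EXACTLY modulo them: two tables give the same REFL table iff they differ by a `γ₀`-periodic table
(`κ` cancellable).  This is the precise freedom left in the seam (γ′). -/
theorem reflTable_eq_iff_periodic {Γ : Type*} [Mul Γ] (T T' : Γ → R') {κ : R'} (hκ : IsUnit κ) (γ₀ : Γ) :
    ((fun γ => κ * (T γ - T (γ * γ₀))) = fun γ => κ * (T' γ - T' (γ * γ₀))) ↔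
      ∀ γ : Γ, T (γ * γ₀) - T' (γ * γ₀) = T γ - T' γ := by
  rw [funext_iff]
  refine forall_congr' fun γ => ⟨fun h => ?_, fun h => ?_⟩
  · have h' := hκ.mul_left_cancel h
    linear_combination -h'
  · congr 1; linear_combination -h

/-- A8 ★ **PERIODIC TABLES ARE INVISIBLE to the characters the consumer uses** (`ψ(γγ₀) = −ψ γ`, i.e. `ψ(γ₀) = −1`
for a multiplicative `ψ`; `γ₀² = 1`; `2` a non-zero-divisor): `Σ_γ ψ(γ)·C(γ) = 0`. -/
theorem sum_mul_periodic_eq_zero {Γ : Type*} [Group Γ] [Fintype Γ] [NoZeroDivisors R'] (h2 : (2 : R') ≠ 0)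
    (ψ C : Γ → R') (γ₀ : Γ) (hγ₀ : γ₀ * γ₀ = 1)
    (hψ : ∀ γ : Γ, ψ (γ * γ₀) = -ψ γ) (hC : ∀ γ : Γ, C (γ * γ₀) = C γ) :
    ∑ γ : Γ, ψ γ * C γ = 0 := by
  have hre : ∑ γ : Γ, ψ (γ * γ₀) * C (γ * γ₀) = ∑ γ : Γ, ψ γ * C γ :=
    Fintype.sum_equiv (Equiv.mulRight γ₀) _ _ fun _ => rfl
  simp_rw [hψ, hC, neg_mul, Finset.sum_neg_distrib] at hre
  have h2S : (2 : R') * ∑ γ : Γ, ψ γ * C γ = 0 := by linear_combination -hre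
  exact (mul_eq_zero.mp h2S).resolve_left h2

/-- A8′. Hence the consumer's character sum of `T + C` is that of `T`. -/
theorem sum_mul_add_periodic {Γ : Type*} [Group Γ] [Fintype Γ] [NoZeroDivisors R'] (h2 : (2 : R') ≠ 0)
    (ψ T C : Γ → R') (γ₀ : Γ) (hγ₀ : γ₀ * γ₀ = 1)
    (hψ : ∀ γ : Γ, ψ (γ * γ₀) = -ψ γ) (hC : ∀ γ : Γ, C (γ * γ₀) = C γ) :
    ∑ γ : Γ, ψ γ * (T γ + C γ) = ∑ γ : Γ, ψ γ * T γ := by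
  simp_rw [mul_add, Finset.sum_add_distrib, sum_mul_periodic_eq_zero h2 ψ C γ₀ hγ₀ hψ hC, add_zero]

/-- A9 ★ **SEAM-MOD-PERIODIC = DIFFERENCE SEAM** (additive groups): `L = T + C` for SOME `γ₀`-periodic `C` iff
`L(γ) − L(γγ₀) = T(γ) − T(γγ₀)` for all `γ` — so A3 and A4 are the same weakening, and by A6 it is sharp. -/
theorem exists_periodic_iff_diffSeam {A : Type*} [AddCommGroup A] {Γ : Type*} [Mul Γ] (L T : Γ → A) (γ₀ : Γ) :
    (∃ C : Γ → A, (∀ γ, C (γ * γ₀) = C γ) ∧ ∀ γ, L γ = T γ + C γ) ↔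
      ∀ γ : Γ, L γ - L (γ * γ₀) = T γ - T (γ * γ₀) := by
  constructor
  · rintro ⟨C, hC, hL⟩ γ
    rw [hL, hL, hC]; abel
  · intro h
    refine ⟨fun γ => L γ - T γ, fun γ => ?_, fun γ => (add_sub_cancel (T γ) (L γ)).symm⟩
    have := h γ
    simp only
    rw [sub_eq_sub_iff_sub_eq_sub] at this
    rw [← this]

/-- Degenerate instance (vacuity check, B68): constant `V`, `T = 0`, `D = 0` satisfy A2 with `ℓ = 0`. -/
example {M : ℕ} (hMN : M ∣ N) {Γ : Type*} [Mul Γ] (e : Γ ≃ (ZMod N)ˣ) (c κ : R') (γ₀ : Γ) :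
    RamifiedReading hMN (fun _ : ZMod N => c) (fun _ : ZMod N => c + -c) (fun _ : ZMod M => -c) e
      (fun γ => κ * ((0 : Γ → R') γ - (0 : Γ → R') (γ * γ₀))) :=
  read₂_of_unit_identity hMN e (fun _ => c) 0 0 κ c γ₀ (fun _ => by simp) (fun _ => by simp)

end Glue

/-! ### §B  The index model of (δ) (Mathlib-only, PROVED): `Γ = (ℤ/2^{n+1})ˣ`, `e = refl`, `γ₀ = 1 + 2^n` (`n ≥ 1`),
`γ·γ₀ = γ + 2^n`, `γ₀² = 1`; `γ₀`-periodic = pulled back from level `n`. -/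
section Index

theorem coprime_one_add_two_pow (n : ℕ) (hn : 1 ≤ n) : Nat.Coprime (1 + 2 ^ n) (2 ^ (n + 1)) := by
  have hodd : Odd (1 + 2 ^ n) := by
    obtain ⟨k, rfl⟩ := Nat.exists_eq_add_of_le hn
    exact ⟨2 ^ k, by ring⟩
  exact (Nat.coprime_two_right.mpr hodd).pow_right (n + 1)

/-- `γ₀ := 1 + 2^n ∈ (ℤ/2^{n+1})ˣ` (`n ≥ 1`) — the index shift `a ↦ a + 2^n` (`ζ^{a+2^n} = −ζ^a`) as a unit. -/
def shiftUnit (n : ℕ) (hn : 1 ≤ n) : (ZMod (2 ^ (n + 1)))ˣ :=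
  ZMod.unitOfCoprime (1 + 2 ^ n) (coprime_one_add_two_pow n hn)

theorem coe_shiftUnit (n : ℕ) (hn : 1 ≤ n) : (shiftUnit n hn : ZMod (2 ^ (n + 1))) = 1 + 2 ^ n := by
  rw [shiftUnit, ZMod.coe_unitOfCoprime, Nat.cast_add, Nat.cast_one, Nat.cast_pow, Nat.cast_ofNat]

theorem two_pow_succ_eq_zero (n : ℕ) : (2 : ZMod (2 ^ (n + 1))) ^ (n + 1) = 0 := by
  have h := ZMod.natCast_self (2 ^ (n + 1))
  push_cast at h
  exact h

theorem two_pow_mul_two_pow_eq_zero (n : ℕ) (hn : 1 ≤ n) : (2 : ZMod (2 ^ (n + 1))) ^ n * 2 ^ n = 0 := by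
  rw [← pow_add]
  exact pow_eq_zero_of_le (by omega) (two_pow_succ_eq_zero n)

/-- `γ₀² = 1`. -/
theorem shiftUnit_mul_self (n : ℕ) (hn : 1 ≤ n) : shiftUnit n hn * shiftUnit n hn = 1 := by
  apply Units.ext
  rw [Units.val_mul, coe_shiftUnit, Units.val_one]
  linear_combination two_pow_mul_two_pow_eq_zero n hn + two_pow_succ_eq_zero n

/-- Units are odd: `γ · 2^n = 2^n` in `ℤ/2^{n+1}`. -/
theorem unit_mul_two_pow (n : ℕ) (γ : (ZMod (2 ^ (n + 1)))ˣ) :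
    (γ : ZMod (2 ^ (n + 1))) * 2 ^ n = 2 ^ n := by
  have hcop := ZMod.val_coe_unit_coprime γ
  have hodd : Odd (γ : ZMod (2 ^ (n + 1))).val :=
    Nat.coprime_two_right.mp (Nat.Coprime.coprime_dvd_right ⟨2 ^ n, by ring⟩ hcop)
  obtain ⟨k, hk⟩ := hodd
  have hmul : (γ : ZMod (2 ^ (n + 1))) * 2 ^ n =
      (k : ZMod (2 ^ (n + 1))) * ((2 : ZMod (2 ^ (n + 1))) ^ n * 2) + 2 ^ n := by
    conv_lhs => rw [← ZMod.natCast_zmod_val (γ : ZMod (2 ^ (n + 1))), hk]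
    push_cast
    ring
  rw [hmul, ← pow_succ, two_pow_succ_eq_zero, mul_zero, zero_add]

/-- ★ `hshift` of `read₂_of_refl_cut` in the index model: `γ·γ₀ = γ + 2^n`. -/
theorem coe_mul_shiftUnit (n : ℕ) (hn : 1 ≤ n) (γ : (ZMod (2 ^ (n + 1)))ˣ) :
    ((γ * shiftUnit n hn : (ZMod (2 ^ (n + 1)))ˣ) : ZMod (2 ^ (n + 1))) = (γ : ZMod (2 ^ (n + 1))) + 2 ^ n := by
  rw [Units.val_mul, coe_shiftUnit, mul_add, mul_one, unit_mul_two_pow n γ]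

/-- ★ `γ₀`-PERIODIC = LEVEL `n`: every table pulled back along `ℤ/2^{n+1} → ℤ/2^n` is `γ₀`-periodic. -/
theorem periodic_of_level (n : ℕ) (hn : 1 ≤ n) {R' : Type*} (C' : ZMod (2 ^ n) → R') (γ : (ZMod (2 ^ (n + 1)))ˣ) :
    C' (ZMod.castHom (pow_dvd_pow 2 (Nat.le_succ n)) (ZMod (2 ^ n)) ((γ * shiftUnit n hn : (ZMod (2 ^ (n + 1)))ˣ) :
      ZMod (2 ^ (n + 1)))) =
      C' (ZMod.castHom (pow_dvd_pow 2 (Nat.le_succ n)) (ZMod (2 ^ n)) (γ : ZMod (2 ^ (n + 1)))) := by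
  congr 1
  rw [coe_mul_shiftUnit, map_add, map_pow, map_ofNat]
  have h := ZMod.natCast_self (2 ^ n)
  push_cast at h
  rw [h, add_zero]

/-- Finite-level sanity (B68): `n = 1, 2`. -/
example : ∀ u : ZMod 8, IsUnit u → u * 4 = 4 := by decide
example : ((1 + 4 : ZMod 8)) * (1 + 4) = 1 := by decide
example : ∀ u : ZMod 4, IsUnit u → u * (1 + 2) = u + 2 := by decide

end Index

/-! ### §C  The (δ)-CORE on the ℂ_F side (PROVED): `Q̄_β(ϑ̄ z)·g̃_β(ϑ̄ z') = g̃_β(ϑ̄ z)` for `z' = −2 − z`, hence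
`plog θ Q̄_β(ϑ̄ z) = Lg_β z − Lg_β z'` and `V_β(z) = ½(Lg_β z − Lg_β z') + c_β` — the `hS1` of `read₂_of_refl_cut`
AT THE WITNESS, at every reflecting pair. -/

/-- C0. Principal units: `q·r = x` with `r, x` principal ⟹ `q` principal. -/
theorem norm_one_sub_lt_of_mul_eq {𝕜 : Type*} [NormedField 𝕜] [IsUltrametricDist 𝕜] {x q r : 𝕜}
    (hr : ‖1 - r‖ < 1) (hx : ‖1 - x‖ < 1) (h : q * r = x) : ‖1 - q‖ < 1 := by
  have hr1 := Literature.NumberTheory.Transcendental.IwasawaLog.norm_eq_one_of_norm_one_sub_lt hr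
  have hr0 : r ≠ 0 := fun h0 => by rw [h0, norm_zero] at hr1; exact zero_ne_one hr1
  have hq : q = x * r⁻¹ := by rw [← h, mul_inv_cancel_right₀ hr0]
  rw [hq]
  exact Literature.NumberTheory.Transcendental.IwasawaLog.norm_one_sub_mul_lt hx
    (Literature.NumberTheory.Transcendental.IwasawaLog.norm_one_sub_inv_lt hr)

/-- `ζ^m = ζ^{m mod N}` when `ζ^N = 1`. -/
theorem pow_eq_pow_mod_of_pow_eq_one {K : Type*} [Monoid K] {ζ : K} {N : ℕ} (hζ : ζ ^ N = 1) (m : ℕ) :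
    ζ ^ m = ζ ^ (m % N) := by
  conv_lhs => rw [← Nat.mod_add_div m N, pow_add, pow_mul, hζ, one_pow, mul_one]

section ReflectC

open ValuativeRel IsLocalRing Field
open Literature.NumberTheory.GaloisRepresentations Literature.NumberTheory.GaloisRepresentations.IsNonarchimedeanLocalField
  Literature.NumberTheory.GaloisRepresentations.LubinTate Literature.NumberTheory.PAdicHodge

variable {F : Type} [Field F] [ValuativeRel F] [TopologicalSpace F] [IsNonarchimedeanLocalField F]

attribute [local instance] ltNormUniformSpace ltNormIsUniformAddGroup rk1 nF nE fintypeResidueField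

variable (hq : residueFieldCard F = 2) (E : IntermediateField F (AlgebraicClosure F)) [FiniteDimensional F E]

include hq in
/-- C1 ★ **`(τ_E G)(y) = G(−π' − y)` on `𝔪_ℂ`**, hypothesis-free in `G ∈ 𝒪_E⟦X⟧` — the ℂ_F-side REFLECTION LAW
(`reflE` is `evT` at `X [+] (−π') = −π' − X`; pushed along `𝒪_E → 𝒪_ℂ` by `map_evT`, evaluated by `evS_evT`).
The tree's `evS_map_reflect_of_reflE_eq_neg` is the special case `τ_E G = −G`. [cite: deShalit1987, I.3.3 (7)] -/
theorem evS_map_reflE {π' : 𝒪[F]} (hπ' : (valuation F).IsUniformizer (π' : F))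
    (G : PowerSeries (unitBall E)) (y y' : (maxNilIdealC F).toIdeal)
    (hy' : ((y' : CBall F) : CompletedAlgClosure F) =
      -algebraMap F (CompletedAlgClosure F) (π' : F) - ((y : CBall F) : CompletedAlgClosure F)) :
    evS (maxNilIdealC F) y ((reflE hπ' E G).map (unitBallToCBall E)) =
      evS (maxNilIdealC F) y' (G.map (unitBallToCBall E)) := by
  set ψ : unitBall E →+* CBall F := unitBallToCBall E with hψ
  set t₁ := tPt (maxNilIdeal F E) (isLTRing_LTCoeff hπ') (isLTSeries_LTCoeff π') (divPtTwo hπ' E 1) with ht₁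
  have h1 : reflE hπ' E G = evT (maxNilIdeal F E) t₁ G := by rw [ht₁]; exact reflE_apply hπ' E G
  have ht₁C : PowerSeries.map ψ (t₁ : PowerSeries (unitBall E)) =
      -PowerSeries.X - PowerSeries.C (ψ (algebraMap 𝒪[F] (unitBall E) π')) := by
    rw [ht₁, coe_tPt_divPtTwo hπ' E hq one_ne_zero, map_sub, map_neg, PowerSeries.map_X, PowerSeries.map_C]
  have hπC : ((ψ (algebraMap 𝒪[F] (unitBall E) π') : CBall F) : CompletedAlgClosure F) =
      algebraMap F (CompletedAlgClosure F) (π' : F) := coe_unitBallToCBall_algebraMap E π'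
  have htmem : PowerSeries.map ψ (t₁ : PowerSeries (unitBall E)) ∈ (seriesNilIdeal (maxNilIdealC F)).toIdeal := by
    rw [mem_seriesNilIdeal_iff, ht₁C, map_sub, map_neg, PowerSeries.constantCoeff_X, neg_zero, zero_sub,
      PowerSeries.constantCoeff_C]
    refine neg_mem ?_
    change ‖((ψ (algebraMap 𝒪[F] (unitBall E) π') : CBall F) : CompletedAlgClosure F)‖ < 1
    rw [hπC, CompletedAlgClosure.norm_algebraMap]
    exact (norm_lt_one_iff F _).mpr hπ'.val_lt_one
  have hmap := congrArg (PowerSeries.map ψ) h1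
  rw [map_evT (maxNilIdeal F E) (maxNilIdealC F) ψ (continuous_unitBallToCBall E) t₁ htmem] at hmap
  have hev := congrArg (evS (maxNilIdealC F) y) hmap
  rw [evS_evT] at hev
  have hpt : evSPt (maxNilIdealC F) y ⟨PowerSeries.map ψ (t₁ : PowerSeries (unitBall E)), htmem⟩ = y' := by
    apply Subtype.ext; apply Subtype.ext
    change (((evS (maxNilIdealC F) y (PowerSeries.map ψ (t₁ : PowerSeries (unitBall E)))) : CBall F) :
      CompletedAlgClosure F) = _
    rw [ht₁C, map_sub, map_neg, evS_X, evS_C, hy']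
    push_cast
    rw [hπC]
    ring
  rw [hpt] at hev
  exact hev

end ReflectC

section Witness

open ValuativeRel IsLocalRing Field
open Literature.NumberTheory.Transcendental
open Literature.NumberTheory.GaloisRepresentations Literature.NumberTheory.GaloisRepresentations.IsNonarchimedeanLocalField
  Literature.NumberTheory.GaloisRepresentations.LubinTate Literature.NumberTheory.PAdicHodge
  Literature.NumberTheory.EllipticCurves
open InstCoreK1G41 (thetaBar constantCoeff_thetaBar reflQuotC reflQuotN gaugeUnit gaugeConst)

variable {F : Type} [Field F] [ValuativeRel F] [TopologicalSpace F] [IsNonarchimedeanLocalField F]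

attribute [local instance] ltNormUniformSpace ltNormIsUniformAddGroup rk1 nF nE fintypeResidueField

variable (hq : residueFieldCard F = 2) (h2 : (valuation F).IsUniformizer (((2 : ℕ) : 𝒪[F]) : F)) (u : 𝒪[F]ˣ)
variable (E : IntermediateField F (AlgebraicClosure F)) [FiniteDimensional F E] [Normal F E] [IsGalois F E]
  (hE : E ≤ maxUnramified F) {σ₀ : absoluteGaloisGroup F} (hσ₀ : IsAbsArithFrob σ₀)
variable {ε : (maxUnramifiedCompletion F)ˣ}
  (hε : maxUnramifiedCompletion.galAut F σ₀ (ε : maxUnramifiedCompletion F) =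
    algebraMap 𝒪[F] (maxUnramifiedCompletion F) (u : 𝒪[F]) * (ε : maxUnramifiedCompletion F))
variable (θ : CompletedAlgClosure F →+* ℂ_[2]) (hθc : Continuous θ)
  (hθ1 : ∀ z : CBall F, ‖θ (z : CompletedAlgClosure F)‖ ≤ 1)
  (hθlt : ∀ x : CompletedAlgClosure F, ‖x‖ < 1 → ‖θ x‖ < 1)

/-- C2. `ḡ_β` — the relative Coleman series `g_β` (k3-g39's `gUnit`) read in `𝒪_ℂ⟦X⟧`. -/
def gC (β : RelNormCoherentUnits (isUniformizer_unit_mul h2 u) E) : PowerSeries (CBall F) :=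
  (ReflectionPrimitiveK3G39.gUnit (isUniformizer_unit_mul h2 u) E hq hE hσ₀ β : PowerSeries (unitBall E)).map
    (unitBallToCBall E)

theorem isUnit_gC (β : RelNormCoherentUnits (isUniformizer_unit_mul h2 u) E) : IsUnit (gC hq h2 u E hE hσ₀ β) :=
  (ReflectionPrimitiveK3G39.gUnit (isUniformizer_unit_mul h2 u) E hq hE hσ₀ β).isUnit.map
    (PowerSeries.map (unitBallToCBall E))

theorem isUnit_constantCoeff_gC (β : RelNormCoherentUnits (isUniformizer_unit_mul h2 u) E) :
    IsUnit (PowerSeries.constantCoeff (gC hq h2 u E hE hσ₀ β)) :=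
  PowerSeries.isUnit_iff_constantCoeff.mp (isUnit_gC hq h2 u E hE hσ₀ β)

/-- `g_β(0)` read in `𝒪_ℂ`, as a unit (it is NOT a principal unit in general — log-branch remark (β′)). -/
def baseUnit (β : RelNormCoherentUnits (isUniformizer_unit_mul h2 u) E) : (CBall F)ˣ :=
  (isUnit_constantCoeff_gC hq h2 u E hE hσ₀ β).unit

theorem coe_baseUnit (β : RelNormCoherentUnits (isUniformizer_unit_mul h2 u) E) :
    (baseUnit hq h2 u E hE hσ₀ β : CBall F) = PowerSeries.constantCoeff (gC hq h2 u E hE hσ₀ β) := rfl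

/-- C2′. `g̃_β := g_β(0)⁻¹ · ḡ_β` — the PRINCIPAL normalisation (`g̃_β(0) = 1`). -/
def gN (β : RelNormCoherentUnits (isUniformizer_unit_mul h2 u) E) : PowerSeries (CBall F) :=
  PowerSeries.C ((↑(baseUnit hq h2 u E hE hσ₀ β)⁻¹ : CBall F)) * gC hq h2 u E hE hσ₀ β

theorem constantCoeff_gN (β : RelNormCoherentUnits (isUniformizer_unit_mul h2 u) E) :
    PowerSeries.constantCoeff (gN hq h2 u E hE hσ₀ β) = 1 :=
  InstCoreK1G41.constantCoeff_C_inv_mul (baseUnit hq h2 u E hE hσ₀ β) (coe_baseUnit hq h2 u E hE hσ₀ β).symm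

include hq in
/-- C3 ★ `Q̄_β(y) · ḡ_β(y') = ḡ_β(y)` for `y' = −π' − y` in `𝔪_ℂ` (`π' = u·2`): k1-g41's `Q_β · τ_E g_β = g_β` mapped to
`𝒪_ℂ⟦X⟧`, evaluated, and C1. -/
theorem evS_reflQuotC_mul_evS_gC (β : RelNormCoherentUnits (isUniformizer_unit_mul h2 u) E)
    (y y' : (maxNilIdealC F).toIdeal)
    (hy' : ((y' : CBall F) : CompletedAlgClosure F) =
      -algebraMap F (CompletedAlgClosure F) ((((u : 𝒪[F]) * ((2 : ℕ) : 𝒪[F]) : 𝒪[F]) : F)) -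
        ((y : CBall F) : CompletedAlgClosure F)) :
    evS (maxNilIdealC F) y (reflQuotC hq h2 u E hE hσ₀ β) * evS (maxNilIdealC F) y' (gC hq h2 u E hE hσ₀ β) =
      evS (maxNilIdealC F) y (gC hq h2 u E hE hσ₀ β) := by
  have h := congrArg (PowerSeries.map (unitBallToCBall E)) (InstCoreK1G41.reflQuot_mul_reflE hq h2 u E hE hσ₀ β)
  rw [map_mul] at h
  have hev := congrArg (evS (maxNilIdealC F) y) h
  rw [map_mul, evS_map_reflE hq E (isUniformizer_unit_mul h2 u) _ y y' hy'] at hev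
  exact hev

/-- The `ϑ̄`-point of `z`: `ϑ̄(z) ∈ 𝔪_ℂ`. -/
def thetaPt (z : (maxNilIdealC F).toIdeal) : (maxNilIdealC F).toIdeal :=
  ⟨evS (maxNilIdealC F) z (thetaBar h2 u hσ₀ hε),
    evS_mem_of_constantCoeff_eq_zero _ z (constantCoeff_thetaBar h2 u hσ₀ hε)⟩

theorem thetaPt_eq_evalPt₁ (z : (maxNilIdealC F).toIdeal) :
    thetaPt h2 u hσ₀ hε z =
      evalPt₁ (maxNilIdealC F) (compSeriesC h2 hσ₀ u hε) (constantCoeff_compSeriesC h2 hσ₀ u hε) z :=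
  (evalPt₁_compSeriesC_eq_mk_evS hσ₀ u hε h2 z).symm

include hq in
/-- `ϑ̄` intertwines the two reflections: `ϑ̄(z') = −π' − ϑ̄(z)` for `z' = −2 − z` (tree `coe_evalPt₁_compSeriesC_reflect`). -/
theorem coe_thetaPt_reflect (z z' : (maxNilIdealC F).toIdeal)
    (hz' : ((z' : CBall F) : CompletedAlgClosure F) = -2 - ((z : CBall F) : CompletedAlgClosure F)) :
    ((thetaPt h2 u hσ₀ hε z' : CBall F) : CompletedAlgClosure F) =
      -algebraMap F (CompletedAlgClosure F) ((((u : 𝒪[F]) * ((2 : ℕ) : 𝒪[F]) : 𝒪[F]) : F)) -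
        ((thetaPt h2 u hσ₀ hε z : CBall F) : CompletedAlgClosure F) := by
  rw [thetaPt_eq_evalPt₁, thetaPt_eq_evalPt₁]
  exact coe_evalPt₁_compSeriesC_reflect hq h2 hσ₀ u hε z z' hz'

theorem evS_subst_thetaBar (z : (maxNilIdealC F).toIdeal) (G : PowerSeries (CBall F)) :
    evS (maxNilIdealC F) z (PowerSeries.subst (thetaBar h2 u hσ₀ hε) G) =
      evS (maxNilIdealC F) (thetaPt h2 u hσ₀ hε z) G :=
  evS_subst (maxNilIdealC F) z (constantCoeff_thetaBar h2 u hσ₀ hε) G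

include hq in
/-- C4 ★ `Q̄_β(ϑ̄ z) · ḡ_β(ϑ̄ z') = ḡ_β(ϑ̄ z)` for `z' = −2 − z`. -/
theorem reflQuot_thetaBar_mul_gC (β : RelNormCoherentUnits (isUniformizer_unit_mul h2 u) E)
    (z z' : (maxNilIdealC F).toIdeal)
    (hz' : ((z' : CBall F) : CompletedAlgClosure F) = -2 - ((z : CBall F) : CompletedAlgClosure F)) :
    evS (maxNilIdealC F) z (PowerSeries.subst (thetaBar h2 u hσ₀ hε) (reflQuotC hq h2 u E hE hσ₀ β)) *
        evS (maxNilIdealC F) z' (PowerSeries.subst (thetaBar h2 u hσ₀ hε) (gC hq h2 u E hE hσ₀ β)) =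
      evS (maxNilIdealC F) z (PowerSeries.subst (thetaBar h2 u hσ₀ hε) (gC hq h2 u E hE hσ₀ β)) := by
  rw [evS_subst_thetaBar, evS_subst_thetaBar, evS_subst_thetaBar]
  exact evS_reflQuotC_mul_evS_gC hq h2 u E hE hσ₀ β _ _ (coe_thetaPt_reflect hq h2 u hσ₀ hε z z' hz')

include hq in
/-- C4′ ★ normalised: `Q̄_β(ϑ̄ z) · g̃_β(ϑ̄ z') = g̃_β(ϑ̄ z)` (the quotient is gauge-invariant, k1-g41 (β′)). -/
theorem reflQuot_thetaBar_mul_gN (β : RelNormCoherentUnits (isUniformizer_unit_mul h2 u) E)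
    (z z' : (maxNilIdealC F).toIdeal)
    (hz' : ((z' : CBall F) : CompletedAlgClosure F) = -2 - ((z : CBall F) : CompletedAlgClosure F)) :
    evS (maxNilIdealC F) z (PowerSeries.subst (thetaBar h2 u hσ₀ hε) (reflQuotC hq h2 u E hE hσ₀ β)) *
        evS (maxNilIdealC F) z' (PowerSeries.subst (thetaBar h2 u hσ₀ hε) (gN hq h2 u E hE hσ₀ β)) =
      evS (maxNilIdealC F) z (PowerSeries.subst (thetaBar h2 u hσ₀ hε) (gN hq h2 u E hE hσ₀ β)) := by
  have h := reflQuot_thetaBar_mul_gC hq h2 u E hE hσ₀ hε β z z' hz'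
  rw [evS_subst_thetaBar, evS_subst_thetaBar, evS_subst_thetaBar] at h ⊢
  simp only [gN, map_mul, evS_C]
  rw [mul_left_comm, h]

/-- `Lg_β w := plog θ(g̃_β(ϑ̄ w))` — the `Lg`-table of `read₂_of_refl_cut` ON THE PRINCIPAL NORMALISATION. -/
def Lg (β : RelNormCoherentUnits (isUniformizer_unit_mul h2 u) E) (w : (maxNilIdealC F).toIdeal) : ℂ_[2] :=
  PadicExp.plog (θ ((evS (maxNilIdealC F) w
    (PowerSeries.subst (thetaBar h2 u hσ₀ hε) (gN hq h2 u E hE hσ₀ β)) : CBall F) : CompletedAlgClosure F))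

include hθlt in
/-- `θ(g̃_β(ϑ̄ w))` is a principal unit of `ℂ₂` (`g̃_β(0) = 1`, k3-g40 `norm_one_sub_evS_lt_one`, and `hθlt`). -/
theorem norm_one_sub_theta_gN_lt (β : RelNormCoherentUnits (isUniformizer_unit_mul h2 u) E)
    (w : (maxNilIdealC F).toIdeal) :
    ‖1 - θ ((evS (maxNilIdealC F) w
      (PowerSeries.subst (thetaBar h2 u hσ₀ hε) (gN hq h2 u E hE hσ₀ β)) : CBall F) : CompletedAlgClosure F)‖ < 1 := by
  rw [evS_subst_thetaBar, ← map_one θ, ← map_sub]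
  refine hθlt _ ?_
  have h := ReadTwoCutK3G40.norm_one_sub_evS_lt_one (gN hq h2 u E hE hσ₀ β) (constantCoeff_gN hq h2 u E hE hσ₀ β)
    (thetaPt h2 u hσ₀ hε w)
  simpa using h

include hq hθlt in
/-- C5 ★★ **THE PLOG SPLIT AT A REFLECTING PAIR**: `plog θ(Q̄_β(ϑ̄ z)) = Lg_β z − Lg_β z'` (`z' = −2 − z`). -/
theorem plog_reflQuot_thetaBar_eq_sub (β : RelNormCoherentUnits (isUniformizer_unit_mul h2 u) E)
    (z z' : (maxNilIdealC F).toIdeal)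
    (hz' : ((z' : CBall F) : CompletedAlgClosure F) = -2 - ((z : CBall F) : CompletedAlgClosure F)) :
    PadicExp.plog (θ ((evS (maxNilIdealC F) z
        (PowerSeries.subst (thetaBar h2 u hσ₀ hε) (reflQuotC hq h2 u E hE hσ₀ β)) : CBall F) :
          CompletedAlgClosure F)) =
      Lg hq h2 u E hE hσ₀ hε θ β z - Lg hq h2 u E hE hσ₀ hε θ β z' := by
  have hmul := congrArg (fun s : CBall F => θ (s : CompletedAlgClosure F))
    (reflQuot_thetaBar_mul_gN hq h2 u E hE hσ₀ hε β z z' hz')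
  simp only [Subring.coe_mul, map_mul] at hmul
  have hr := norm_one_sub_theta_gN_lt hq h2 u E hE hσ₀ hε θ hθlt β z'
  have hx := norm_one_sub_theta_gN_lt hq h2 u E hE hσ₀ hε θ hθlt β z
  exact ReadTwoCutK3G40.plog_eq_sub_of_mul_eq (norm_one_sub_lt_of_mul_eq hr hx hmul) hr hmul

include hθc hθ1 in
/-- C6 ★ **z-UNIFORM WITNESS (strongest provable form of (α))**: ONE pair `(L, y)` — hence ONE reading series
`(L∘y)∘ϑ̄ ∈ 𝒪_ℂ⟦S⟧` — whose `θ`-value at EVERY `z₀ ∈ 𝔪_ℂ` is `½·plog θ(P_β(ϑ̄ z₀))`.  (k1-g41/J10 chose `L, y`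
after `z₀`; (δ) needs one series for the whole torsion packet.) -/
theorem inst₂_core_uniform (β : RelNormCoherentUnits (isUniformizer_unit_mul h2 u) E) :
    ∃ L y : PowerSeries (CBall F), PowerSeries.constantCoeff y = 0 ∧
      reflQuotN hq h2 u E hE hσ₀ β = 1 + PowerSeries.C (2 : CBall F) * y ∧
      θ ((PowerSeries.coeff 0 L : CBall F) : CompletedAlgClosure F) = 0 ∧
      ∀ z₀ : (maxNilIdealC F).toIdeal,
        ∑' m : ℕ, PowerSeries.coeff m (PowerSeries.map (θ.comp (CBall F).subtype)
            (PowerSeries.subst (thetaBar h2 u hσ₀ hε) (PowerSeries.subst y L))) *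
            (θ ((z₀ : CBall F) : CompletedAlgClosure F)) ^ m =
          (2 : ℂ_[2])⁻¹ * PadicExp.plog
            (θ ((evS (maxNilIdealC F) z₀
              (PowerSeries.subst (thetaBar h2 u hσ₀ hε) (reflQuotN hq h2 u E hE hσ₀ β)) : CBall F) :
                CompletedAlgClosure F)) := by
  obtain ⟨y, hy0, hPy⟩ := DisjointShiftK2G41.exists_eq_one_add_C_mul (2 : CBall F) (reflQuotN hq h2 u E hE hσ₀ β)
    (InstCoreK1G41.constantCoeff_reflQuotN hq h2 u E hE hσ₀ β) (InstCoreK1G41.two_dvd_coeff_succ_reflQuotN hq h2 u E hE hσ₀ β)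
  obtain ⟨L, hL0, hL⟩ := DisjointShiftK2G41.exists_Lam2_lift_map (norm_two_lt_one_C h2) θ
  refine ⟨L, y, hy0, hPy, hL0, fun z₀ => ?_⟩
  rw [ReadTwoCutK3G40.tsum_coeff_map_subst_mul_pow_eq θ hθc (PowerSeries.subst y L) (thetaBar h2 u hσ₀ hε)
      (constantCoeff_thetaBar h2 u hσ₀ hε) z₀,
    evS_subst (maxNilIdealC F) z₀ (constantCoeff_thetaBar h2 u hσ₀ hε)]
  exact (ReadTwoCutK3G40.read_value_eq_tsum_lamTerm θ hθc L y hy0 hL0 hL (thetaPt h2 u hσ₀ hε z₀)).trans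
    (ReadTwoCutK3G40.lambda_value_refl_evS θ hθ1 hPy (thetaPt h2 u hσ₀ hε z₀))

/-- C7. `V_β(z) := ½·plog θ(P_β(ϑ̄ z))` — THE VALUE TABLE of the (uniform) reading witness. -/
def readingValue (β : RelNormCoherentUnits (isUniformizer_unit_mul h2 u) E) (z : (maxNilIdealC F).toIdeal) : ℂ_[2] :=
  (2 : ℂ_[2])⁻¹ * PadicExp.plog (θ ((evS (maxNilIdealC F) z
    (PowerSeries.subst (thetaBar h2 u hσ₀ hε) (reflQuotN hq h2 u E hE hσ₀ β)) : CBall F) : CompletedAlgClosure F))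

include hq hθ1 hθlt in
/-- C8 ★★★ **(δ)'s `hS1` AT THE WITNESS, ON THE NOSE**: `V_β(z) = ½·(Lg_β z − Lg_β z') + c_β` at every reflecting
pair `z' = −2 − z` — k1-g41's (β)-key `half_plog_reflQuotN_eq` + C5. -/
theorem readingValue_eq_half_sub (β : RelNormCoherentUnits (isUniformizer_unit_mul h2 u) E)
    (z z' : (maxNilIdealC F).toIdeal)
    (hz' : ((z' : CBall F) : CompletedAlgClosure F) = -2 - ((z : CBall F) : CompletedAlgClosure F)) :
    readingValue hq h2 u E hE hσ₀ hε θ β z =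
      2⁻¹ * (Lg hq h2 u E hE hσ₀ hε θ β z - Lg hq h2 u E hE hσ₀ hε θ β z') + gaugeConst hq h2 u E hE hσ₀ θ β := by
  rw [readingValue, InstCoreK1G41.half_plog_reflQuotN_eq hq h2 u E hE hσ₀ hε θ hθ1 β z,
    plog_reflQuot_thetaBar_eq_sub hq h2 u E hE hσ₀ hε θ hθlt β z z' hz']

/-! ### §D  (δ) ASSEMBLED on a reflecting torsion family, modulo the seam-mod-level-`n`. -/

/-- A `Ĝ_m`-REFLECTING family indexed by `ℤ/2^{n+1}`: `1 + z_{a+2^n} = −(1 + z_a)` (e.g. `z_a = ζ^a − 1`). -/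
def IsReflectingFamily (n : ℕ) (z : ZMod (2 ^ (n + 1)) → (maxNilIdealC F).toIdeal) : Prop :=
  ∀ a : ZMod (2 ^ (n + 1)),
    ((z (a + 2 ^ n) : CBall F) : CompletedAlgClosure F) = -2 - ((z a : CBall F) : CompletedAlgClosure F)

include h2 in
/-- D2 ★ EXISTENCE: a root of unity `ζ ∈ ℂ_F` with `ζ^{2^n} = −1` gives the reflecting family `z_a := ζ^a − 1`
(`‖ζ^a − 1‖ < 1` by the tree's `norm_sub_one_lt_one_of_pow_two_pow_eq_one`). -/
theorem exists_isReflectingFamily (n : ℕ) {ζ : CompletedAlgClosure F} (hζ : ζ ^ 2 ^ n = -1) :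
    ∃ z : ZMod (2 ^ (n + 1)) → (maxNilIdealC F).toIdeal, IsReflectingFamily n z ∧
      ∀ a, ((z a : CBall F) : CompletedAlgClosure F) = ζ ^ (a : ZMod (2 ^ (n + 1))).val - 1 := by
  have hζ2 : ζ ^ 2 ^ (n + 1) = 1 := by rw [pow_succ, pow_mul, hζ]; norm_num
  have hlt : ∀ k : ℕ, ‖ζ ^ k - 1‖ < 1 := fun k =>
    LubinTate.norm_sub_one_lt_one_of_pow_two_pow_eq_one (n := n + 1) (norm_two_lt_one_C h2)
      (by rw [← pow_mul, mul_comm, pow_mul, hζ2, one_pow])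
  choose z hz using fun a : ZMod (2 ^ (n + 1)) => exists_pt_coe_eq (F := F) (hlt a.val)
  refine ⟨z, fun a => ?_, hz⟩
  rw [hz, hz]
  have h2n : (2 ^ n : ZMod (2 ^ (n + 1))).val = 2 ^ n := by
    rw [show (2 ^ n : ZMod (2 ^ (n + 1))) = ((2 ^ n : ℕ) : ZMod (2 ^ (n + 1))) by norm_cast, ZMod.val_natCast]
    exact Nat.mod_eq_of_lt (Nat.pow_lt_pow_right (by norm_num) (Nat.lt_succ_self n))
  have hval : (a + 2 ^ n : ZMod (2 ^ (n + 1))).val = (a.val + 2 ^ n) % 2 ^ (n + 1) := by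
    rw [ZMod.val_add, h2n]
  rw [hval, ← pow_eq_pow_mod_of_pow_eq_one hζ2, pow_add, hζ]
  ring

/-- D3 ★★★ **(δ), MODULO THE SEAM-MOD-LEVEL-n.**  For `n ≥ 1`, any reflecting torsion family `z`, any relative
norm-coherent unit `β`, and ANY table `T` on `(ℤ/2^{n+1})ˣ` congruent to `Lg_β ∘ z` modulo a `γ₀`-periodic table `C`:
k3-g38's `RamifiedReading` holds with `V = V_β ∘ z` (the reading witness's values), `V₁ = V − c_β`, `V₂ = −c_β`,
`e = refl`, `ℓ γ = ½·(T γ − T(γ·γ₀))`.  This is `read₂_of_refl_cut` INSTANTIATED (critic (δ)) — with the seam in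
its weakest form. -/
theorem delta_read₂ (hθ1 : ∀ z : CBall F, ‖θ (z : CompletedAlgClosure F)‖ ≤ 1)
    (hθlt : ∀ x : CompletedAlgClosure F, ‖x‖ < 1 → ‖θ x‖ < 1) (n : ℕ) (hn : 1 ≤ n) (β : RelNormCoherentUnits (isUniformizer_unit_mul h2 u) E)
    (z : ZMod (2 ^ (n + 1)) → (maxNilIdealC F).toIdeal) (hz : IsReflectingFamily n z)
    (T C : (ZMod (2 ^ (n + 1)))ˣ → ℂ_[2]) (hC : ∀ γ, C (γ * shiftUnit n hn) = C γ)
    (hseam : ∀ γ : (ZMod (2 ^ (n + 1)))ˣ,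
      Lg hq h2 u E hE hσ₀ hε θ β (z (γ : ZMod (2 ^ (n + 1)))) = T γ + C γ) :
    ReadTwoCutK3G40.RamifiedReading (pow_dvd_pow 2 (Nat.le_succ n))
      (fun a => readingValue hq h2 u E hE hσ₀ hε θ β (z a))
      (fun a => readingValue hq h2 u E hE hσ₀ hε θ β (z a) + -gaugeConst hq h2 u E hE hσ₀ θ β)
      (fun _ : ZMod (2 ^ n) => -gaugeConst hq h2 u E hE hσ₀ θ β) (Equiv.refl _)
      (fun γ => 2⁻¹ * (T γ - T (γ * shiftUnit n hn))) :=
  read₂_of_refl_cut_of_seam_mod_periodic _ (Equiv.refl _) _ (fun a => Lg hq h2 u E hE hσ₀ hε θ β (z a)) T 2⁻¹ _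
    (2 ^ n) (shiftUnit n hn) C hC (fun γ => coe_mul_shiftUnit n hn γ)
    (fun γ => readingValue_eq_half_sub hq h2 u E hE hσ₀ hε θ hθ1 hθlt β (z γ) (z (γ + 2 ^ n)) (hz γ)) hseam

include hq hθc in
/-- D3′ ★★★ **(δ) FOR THE READING SERIES ITSELF**: there is ONE integral series `R = (L∘y)∘ϑ̄ ∈ 𝒪_ℂ⟦S⟧` (the
reading witness of record, k3-g40/J10 currency) whose `θ`-VALUES `a ↦ Σ_m θ([S^m]R)·θ(z_a)^m` at the torsion family
satisfy k3-g38's `RamifiedReading` with the REFL unit table `½·(T γ − T(γγ₀))`, for any `T ≡ Lg_β∘z (mod level n)`. -/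
theorem delta_read₂_series (hθ1 : ∀ z : CBall F, ‖θ (z : CompletedAlgClosure F)‖ ≤ 1)
    (hθlt : ∀ x : CompletedAlgClosure F, ‖x‖ < 1 → ‖θ x‖ < 1) (n : ℕ) (hn : 1 ≤ n)
    (β : RelNormCoherentUnits (isUniformizer_unit_mul h2 u) E)
    (z : ZMod (2 ^ (n + 1)) → (maxNilIdealC F).toIdeal) (hz : IsReflectingFamily n z)
    (T C : (ZMod (2 ^ (n + 1)))ˣ → ℂ_[2]) (hC : ∀ γ, C (γ * shiftUnit n hn) = C γ)
    (hseam : ∀ γ : (ZMod (2 ^ (n + 1)))ˣ,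
      Lg hq h2 u E hE hσ₀ hε θ β (z (γ : ZMod (2 ^ (n + 1)))) = T γ + C γ) :
    ∃ L y : PowerSeries (CBall F), PowerSeries.constantCoeff y = 0 ∧
      reflQuotN hq h2 u E hE hσ₀ β = 1 + PowerSeries.C (2 : CBall F) * y ∧
      θ ((PowerSeries.coeff 0 L : CBall F) : CompletedAlgClosure F) = 0 ∧
      ReadTwoCutK3G40.RamifiedReading (pow_dvd_pow 2 (Nat.le_succ n))
        (fun a => ∑' m : ℕ, PowerSeries.coeff m (PowerSeries.map (θ.comp (CBall F).subtype)
            (PowerSeries.subst (thetaBar h2 u hσ₀ hε) (PowerSeries.subst y L))) *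
            (θ ((z a : CBall F) : CompletedAlgClosure F)) ^ m)
        (fun a => (∑' m : ℕ, PowerSeries.coeff m (PowerSeries.map (θ.comp (CBall F).subtype)
            (PowerSeries.subst (thetaBar h2 u hσ₀ hε) (PowerSeries.subst y L))) *
            (θ ((z a : CBall F) : CompletedAlgClosure F)) ^ m) + -gaugeConst hq h2 u E hE hσ₀ θ β)
        (fun _ : ZMod (2 ^ n) => -gaugeConst hq h2 u E hE hσ₀ θ β) (Equiv.refl _)
        (fun γ => 2⁻¹ * (T γ - T (γ * shiftUnit n hn))) := by
  obtain ⟨L, y, hy0, hPy, hL0, hval⟩ := inst₂_core_uniform hq h2 u E hE hσ₀ hε θ hθc hθ1 β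
  refine ⟨L, y, hy0, hPy, hL0, ?_⟩
  have hval' : ∀ a : ZMod (2 ^ (n + 1)),
      ∑' m : ℕ, PowerSeries.coeff m (PowerSeries.map (θ.comp (CBall F).subtype)
          (PowerSeries.subst (thetaBar h2 u hσ₀ hε) (PowerSeries.subst y L))) *
          (θ ((z a : CBall F) : CompletedAlgClosure F)) ^ m =
        readingValue hq h2 u E hE hσ₀ hε θ β (z a) := fun a => hval (z a)
  simp_rw [hval']
  exact delta_read₂ hq h2 u E hE hσ₀ hε θ hθ1 hθlt n hn β z hz T C hC hseam

/-- D4 ★ **WHAT THE CONSUMER SEES** (critic g41 `refl_table_charSum` ∘ D3): for every multiplicative character `ψ`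
with `ψ(1 + 2^n) = −1` (= not factoring through level `n`, the only ones `atom_shape` is applied to), the `ψ`-sum of
the witness's unit values is `Σ_γ ψ(γ)·T(γ)` — for ANY `T ≡ Lg_β ∘ z (mod level-n tables)`.  The periodic ambiguity
of the seam has dropped out. -/
theorem delta_charSum (hθ1 : ∀ z : CBall F, ‖θ (z : CompletedAlgClosure F)‖ ≤ 1)
    (hθlt : ∀ x : CompletedAlgClosure F, ‖x‖ < 1 → ‖θ x‖ < 1) (n : ℕ) (hn : 1 ≤ n) (β : RelNormCoherentUnits (isUniformizer_unit_mul h2 u) E)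
    (z : ZMod (2 ^ (n + 1)) → (maxNilIdealC F).toIdeal) (hz : IsReflectingFamily n z)
    (T C : (ZMod (2 ^ (n + 1)))ˣ → ℂ_[2]) (hC : ∀ γ, C (γ * shiftUnit n hn) = C γ)
    (hseam : ∀ γ : (ZMod (2 ^ (n + 1)))ˣ,
      Lg hq h2 u E hE hσ₀ hε θ β (z (γ : ZMod (2 ^ (n + 1)))) = T γ + C γ)
    (ψ : MulChar (ZMod (2 ^ (n + 1))) ℂ_[2]) (hψ : ψ ((shiftUnit n hn : (ZMod (2 ^ (n + 1)))ˣ) : ZMod _) = -1) :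
    ∑ γ : (ZMod (2 ^ (n + 1)))ˣ, ψ (γ : ZMod (2 ^ (n + 1))) *
        (readingValue hq h2 u E hE hσ₀ hε θ β (z γ) + -gaugeConst hq h2 u E hE hσ₀ θ β) =
      ∑ γ : (ZMod (2 ^ (n + 1)))ˣ, ψ (γ : ZMod (2 ^ (n + 1))) * T γ := by
  have hread := delta_read₂ hq h2 u E hE hσ₀ hε θ hθ1 hθlt n hn β z hz T C hC hseam
  have h1 : ∀ γ : (ZMod (2 ^ (n + 1)))ˣ,
      readingValue hq h2 u E hE hσ₀ hε θ β (z γ) + -gaugeConst hq h2 u E hE hσ₀ θ β =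
        2⁻¹ * (T γ - T (γ * shiftUnit n hn)) := fun γ => hread.2 γ
  simp_rw [h1]
  have key := CriticG41.refl_table_charSum (MulEquiv.refl _) ψ T 2⁻¹ (shiftUnit n hn) (shiftUnit_mul_self n hn) hψ
  simp only [MulEquiv.refl_apply] at key
  rw [key, mul_inv_cancel₀ (two_ne_zero' ℂ_[2]), one_mul]

/-- D4′. The same number from the EXACT seam (`C = 0`): the two readings agree — the consumer cannot tell them apart. -/
theorem delta_charSum_indep (n : ℕ) (hn : 1 ≤ n) (T C : (ZMod (2 ^ (n + 1)))ˣ → ℂ_[2])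
    (hC : ∀ γ, C (γ * shiftUnit n hn) = C γ)
    (ψ : MulChar (ZMod (2 ^ (n + 1))) ℂ_[2]) (hψ : ψ ((shiftUnit n hn : (ZMod (2 ^ (n + 1)))ˣ) : ZMod _) = -1) :
    ∑ γ : (ZMod (2 ^ (n + 1)))ˣ, ψ (γ : ZMod (2 ^ (n + 1))) * (T γ + C γ) =
      ∑ γ : (ZMod (2 ^ (n + 1)))ˣ, ψ (γ : ZMod (2 ^ (n + 1))) * T γ :=
  sum_mul_add_periodic (Γ := (ZMod (2 ^ (n + 1)))ˣ) (two_ne_zero' ℂ_[2])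
    (fun γ : (ZMod (2 ^ (n + 1)))ˣ => ψ (γ : ZMod (2 ^ (n + 1)))) T C (shiftUnit n hn)
    (shiftUnit_mul_self n hn)
    (fun γ => by
      show ψ ((γ * shiftUnit n hn : (ZMod (2 ^ (n + 1)))ˣ) : ZMod _) = -ψ (γ : ZMod _)
      rw [Units.val_mul, map_mul, hψ, mul_neg, mul_one]) hC

/-! ### §E  WHAT REMAINS of (γ′) — TYPED.  E1–E3, E6 are STATEMENTS (Props / a table), E4, E5, E7 are PROVED
reductions: the seam-mod-level-`n` (E1) follows with `C = 0` from the VALUE IDENTIFICATION (E3)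
`ι(τ_γ β_n) = ḡ_β(ϑ̄ z_γ)`, which follows from k3-g40's typed sub-stub `LocalUntwistExists` and the ONE remaining
input **E6 `PacketMatching`**: `ϑ̄(z_γ) = ι(σ_{v_γ} ω_{n+1})` in `𝒪_ℂ` (the comparison isomorphism carries the
`Ĝ_m`-packet to de Shalit's coherent Lubin–Tate packet).  Nothing in §E is the stub or the crux. -/

open ReadTwoCutK3G40 (ActsAsFrobPow LocalUntwistExists exists_untwisted_table)

/-- E1. THE REMAINING OBLIGATION of (γ′) after §A–§D, as a Prop: the seam MODULO LEVEL `n` for a unit table `T`. -/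
def SeamModLevel (n : ℕ) (hn : 1 ≤ n) (β : RelNormCoherentUnits (isUniformizer_unit_mul h2 u) E)
    (z : ZMod (2 ^ (n + 1)) → (maxNilIdealC F).toIdeal) (T : (ZMod (2 ^ (n + 1)))ˣ → ℂ_[2]) : Prop :=
  ∃ C : (ZMod (2 ^ (n + 1)))ˣ → ℂ_[2], (∀ γ, C (γ * shiftUnit n hn) = C γ) ∧
    ∀ γ : (ZMod (2 ^ (n + 1)))ˣ, Lg hq h2 u E hE hσ₀ hε θ β (z (γ : ZMod (2 ^ (n + 1)))) = T γ + C γ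

/-- E1′ (PROVED, = D3 repackaged): `SeamModLevel` is exactly what (δ) consumes. -/
theorem delta_read₂_of_seamModLevel (hθ1 : ∀ z : CBall F, ‖θ (z : CompletedAlgClosure F)‖ ≤ 1)
    (hθlt : ∀ x : CompletedAlgClosure F, ‖x‖ < 1 → ‖θ x‖ < 1) (n : ℕ) (hn : 1 ≤ n)
    (β : RelNormCoherentUnits (isUniformizer_unit_mul h2 u) E)
    (z : ZMod (2 ^ (n + 1)) → (maxNilIdealC F).toIdeal) (hz : IsReflectingFamily n z)
    (T : (ZMod (2 ^ (n + 1)))ˣ → ℂ_[2]) (hT : SeamModLevel hq h2 u E hE hσ₀ hε θ n hn β z T) :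
    ReadTwoCutK3G40.RamifiedReading (pow_dvd_pow 2 (Nat.le_succ n))
      (fun a => readingValue hq h2 u E hE hσ₀ hε θ β (z a))
      (fun a => readingValue hq h2 u E hE hσ₀ hε θ β (z a) + -gaugeConst hq h2 u E hE hσ₀ θ β)
      (fun _ : ZMod (2 ^ n) => -gaugeConst hq h2 u E hE hσ₀ θ β) (Equiv.refl _)
      (fun γ => 2⁻¹ * (T γ - T (γ * shiftUnit n hn))) := by
  obtain ⟨C, hC, hseam⟩ := hT
  exact delta_read₂ hq h2 u E hE hσ₀ hε θ hθ1 hθlt n hn β z hz T C hC hseam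

/-- E2. THE TARGET TABLE of record: `T γ := plog (c · θ ι(τ_γ β_n))` — the `ℂ₂`-images (tree `algClosureToC`, then
`θ`) of the Galois conjugates `τ_γ(β_n)` of the level-`n` component of the norm-coherent unit, `τ_γ` the untwisting
automorphisms of k3-g40 `exists_untwisted_table` (`k = 0`), `c` ONE principal-normalising constant. -/
def untwistedLogTable {π : 𝒪[F]} {hπ : (valuation F).IsUniformizer (π : F)} (n : ℕ)
    (β : RelNormCoherentUnits hπ E) (c : ℂ_[2])
    (τ : (ZMod (2 ^ (n + 1)))ˣ → ((E ⊔ ltField π n : IntermediateField F (AlgebraicClosure F)) ≃ₐ[F]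
      (E ⊔ ltField π n : IntermediateField F (AlgebraicClosure F)))) :
    (ZMod (2 ^ (n + 1)))ˣ → ℂ_[2] := fun γ =>
  PadicExp.plog (c * θ (algClosureToC F
    ((τ γ ((β.val n : unitBall (E ⊔ ltField π n : IntermediateField F (AlgebraicClosure F))) :
        (E ⊔ ltField π n : IntermediateField F (AlgebraicClosure F))) :
      (E ⊔ ltField π n : IntermediateField F (AlgebraicClosure F))) : AlgebraicClosure F)))

/-- E3. **VALUE IDENTIFICATION** (statement): the `ℂ_F`-value of `ḡ_β` at `ϑ̄(z_γ)` is the image of the Galois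
conjugate `τ_γ(β_n)` (de Shalit I §2.2 Theorem + the local untwist; Lang, *Cyclotomic Fields* I–II, Ch. 7, CW 2 in the
`Ĝ_m` model). -/
def ValueIdentification (n : ℕ) (β : RelNormCoherentUnits (isUniformizer_unit_mul h2 u) E)
    (z : ZMod (2 ^ (n + 1)) → (maxNilIdealC F).toIdeal)
    (τ : (ZMod (2 ^ (n + 1)))ˣ →
      ((E ⊔ ltField ((u : 𝒪[F]) * ((2 : ℕ) : 𝒪[F])) n : IntermediateField F (AlgebraicClosure F)) ≃ₐ[F]
        (E ⊔ ltField ((u : 𝒪[F]) * ((2 : ℕ) : 𝒪[F])) n : IntermediateField F (AlgebraicClosure F)))) : Prop :=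
  ∀ γ : (ZMod (2 ^ (n + 1)))ˣ,
    algClosureToC F
        ((τ γ ((β.val n : unitBall (E ⊔ ltField ((u : 𝒪[F]) * ((2 : ℕ) : 𝒪[F])) n :
              IntermediateField F (AlgebraicClosure F))) :
            (E ⊔ ltField ((u : 𝒪[F]) * ((2 : ℕ) : 𝒪[F])) n : IntermediateField F (AlgebraicClosure F))) :
          (E ⊔ ltField ((u : 𝒪[F]) * ((2 : ℕ) : 𝒪[F])) n : IntermediateField F (AlgebraicClosure F))) :
          AlgebraicClosure F) =
      ((evS (maxNilIdealC F) (thetaPt h2 u hσ₀ hε (z (γ : ZMod (2 ^ (n + 1))))) (gC hq h2 u E hE hσ₀ β) :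
        CBall F) : CompletedAlgClosure F)

/-- E4 ★ PROVED: VALUE IDENTIFICATION ⟹ the seam-mod-level-`n` for the untwisted log table, with `C = 0` and the
principal-normalising constant `c = θ(ḡ_β(0)⁻¹)`. -/
theorem seamModLevel_of_valueIdentification (n : ℕ) (hn : 1 ≤ n)
    (β : RelNormCoherentUnits (isUniformizer_unit_mul h2 u) E)
    (z : ZMod (2 ^ (n + 1)) → (maxNilIdealC F).toIdeal)
    (τ : (ZMod (2 ^ (n + 1)))ˣ →
      ((E ⊔ ltField ((u : 𝒪[F]) * ((2 : ℕ) : 𝒪[F])) n : IntermediateField F (AlgebraicClosure F)) ≃ₐ[F]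
        (E ⊔ ltField ((u : 𝒪[F]) * ((2 : ℕ) : 𝒪[F])) n : IntermediateField F (AlgebraicClosure F))))
    (hV : ValueIdentification hq h2 u E hE hσ₀ hε n β z τ) :
    SeamModLevel hq h2 u E hE hσ₀ hε θ n hn β z
      (untwistedLogTable E θ n β
        (θ (((↑(baseUnit hq h2 u E hE hσ₀ β)⁻¹ : CBall F)) : CompletedAlgClosure F)) τ) := by
  refine ⟨fun _ => 0, fun _ => rfl, fun γ => ?_⟩
  simp only [Lg, untwistedLogTable, add_zero, evS_subst_thetaBar, gN, map_mul, evS_C, Subring.coe_mul]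
  rw [hV γ]

/-- E5 ★ PROVED (transport, tree `map_evS`): the `ℂ_F`-value of `ḡ_β` at the image of an algebraic point `y` of
`𝔪_{E·F_π^{n+1}}` is the image of the algebraic value `(ι g_β)(y)`. -/
theorem coe_evS_gC_eq (n : ℕ) (β : RelNormCoherentUnits (isUniformizer_unit_mul h2 u) E)
    (y : (maxNilIdeal F (E ⊔ ltField ((u : 𝒪[F]) * ((2 : ℕ) : 𝒪[F])) n :
      IntermediateField F (AlgebraicClosure F))).toIdeal)
    (pt : (maxNilIdealC F).toIdeal)
    (hpt : (pt : CBall F) =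
      unitBallToCBall (E ⊔ ltField ((u : 𝒪[F]) * ((2 : ℕ) : 𝒪[F])) n : IntermediateField F (AlgebraicClosure F))
        (y : unitBall (E ⊔ ltField ((u : 𝒪[F]) * ((2 : ℕ) : 𝒪[F])) n :
          IntermediateField F (AlgebraicClosure F)))) :
    ((evS (maxNilIdealC F) pt (gC hq h2 u E hE hσ₀ β) : CBall F) : CompletedAlgClosure F) =
      algClosureToC F
        (((evS (maxNilIdeal F (E ⊔ ltField ((u : 𝒪[F]) * ((2 : ℕ) : 𝒪[F])) n :
              IntermediateField F (AlgebraicClosure F))) y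
            (PowerSeries.map (inclUnitBall (F := F)
                (le_sup_left : E ≤ E ⊔ ltField ((u : 𝒪[F]) * ((2 : ℕ) : 𝒪[F])) n) :
              unitBall E →+* unitBall (E ⊔ ltField ((u : 𝒪[F]) * ((2 : ℕ) : 𝒪[F])) n :
                IntermediateField F (AlgebraicClosure F)))
              (relColemanSeries (isUniformizer_unit_mul h2 u) E hq hE hσ₀ β)) :
            unitBall (E ⊔ ltField ((u : 𝒪[F]) * ((2 : ℕ) : 𝒪[F])) n :
              IntermediateField F (AlgebraicClosure F))) :
          (E ⊔ ltField ((u : 𝒪[F]) * ((2 : ℕ) : 𝒪[F])) n : IntermediateField F (AlgebraicClosure F))) :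
          AlgebraicClosure F) := by
  have hy : unitBallToCBall (E ⊔ ltField ((u : 𝒪[F]) * ((2 : ℕ) : 𝒪[F])) n :
        IntermediateField F (AlgebraicClosure F))
      (y : unitBall (E ⊔ ltField ((u : 𝒪[F]) * ((2 : ℕ) : 𝒪[F])) n :
        IntermediateField F (AlgebraicClosure F))) ∈ (maxNilIdealC F).toIdeal := by
    rw [← hpt]; exact pt.2
  have key := map_evS
    (maxNilIdeal F (E ⊔ ltField ((u : 𝒪[F]) * ((2 : ℕ) : 𝒪[F])) n : IntermediateField F (AlgebraicClosure F)))
    (maxNilIdealC F)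
    (unitBallToCBall (E ⊔ ltField ((u : 𝒪[F]) * ((2 : ℕ) : 𝒪[F])) n :
      IntermediateField F (AlgebraicClosure F)))
    (continuous_unitBallToCBall (F := F)
      (E := (E ⊔ ltField ((u : 𝒪[F]) * ((2 : ℕ) : 𝒪[F])) n : IntermediateField F (AlgebraicClosure F))))
    y hy
    (PowerSeries.map (inclUnitBall (F := F)
        (le_sup_left : E ≤ E ⊔ ltField ((u : 𝒪[F]) * ((2 : ℕ) : 𝒪[F])) n) :
      unitBall E →+* unitBall (E ⊔ ltField ((u : 𝒪[F]) * ((2 : ℕ) : 𝒪[F])) n :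
        IntermediateField F (AlgebraicClosure F)))
      (relColemanSeries (isUniformizer_unit_mul h2 u) E hq hE hσ₀ β))
  have hpt' : pt = ⟨_, hy⟩ := Subtype.ext hpt
  have hcomp : (unitBallToCBall (F := F) (E ⊔ ltField ((u : 𝒪[F]) * ((2 : ℕ) : 𝒪[F])) n :
        IntermediateField F (AlgebraicClosure F))).comp
      (inclUnitBall (F := F) (le_sup_left : E ≤ E ⊔ ltField ((u : 𝒪[F]) * ((2 : ℕ) : 𝒪[F])) n) :
        unitBall E →+* unitBall (E ⊔ ltField ((u : 𝒪[F]) * ((2 : ℕ) : 𝒪[F])) n :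
          IntermediateField F (AlgebraicClosure F))) = unitBallToCBall (F := F) E :=
    RingHom.ext fun x => Subtype.ext rfl
  have hmap : PowerSeries.map (unitBallToCBall (E ⊔ ltField ((u : 𝒪[F]) * ((2 : ℕ) : 𝒪[F])) n :
        IntermediateField F (AlgebraicClosure F)))
      (PowerSeries.map (inclUnitBall (F := F)
          (le_sup_left : E ≤ E ⊔ ltField ((u : 𝒪[F]) * ((2 : ℕ) : 𝒪[F])) n) :
        unitBall E →+* unitBall (E ⊔ ltField ((u : 𝒪[F]) * ((2 : ℕ) : 𝒪[F])) n :
          IntermediateField F (AlgebraicClosure F)))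
        (relColemanSeries (isUniformizer_unit_mul h2 u) E hq hE hσ₀ β)) = gC hq h2 u E hE hσ₀ β := by
    rw [← RingHom.comp_apply (PowerSeries.map _) (PowerSeries.map _), ← PowerSeries.map_comp, hcomp]; rfl
  rw [hpt', ← hmap, ← key]
  rfl

/-- E6 ★ **THE ONE REMAINING INPUT of the (γ′)+(δ) node, typed — TORSION-PACKET MATCHING** (statement only; NOT
proved here): the `Ĝ_m`-side evaluation points `ϑ̄(z_γ)` ARE (the `𝒪_ℂ`-images of) the Galois translates
`σ_{v_γ}(ι ω_{n+1})` of de Shalit's coherent torsion point of level `n+1`, for some assignment `v : (ℤ/2^{n+1})ˣ → 𝒪_F^×`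
(the comparison isomorphism `ϑ : Ĝ_m ≅ F_{u·2}` over `𝒪_{F̂^nr}` carries `ζ^a − 1 ↦ [a]_{F}(ω)`; k1-g41 J4 /
critic (γ); size S).  With E5/E7 and k3-g40 `LocalUntwistExists` this gives E3, hence E1 with `C = 0` (E4), hence (δ). -/
def PacketMatching (n : ℕ) (z : ZMod (2 ^ (n + 1)) → (maxNilIdealC F).toIdeal)
    (v : (ZMod (2 ^ (n + 1)))ˣ → 𝒪[F]ˣ) : Prop :=
  ∀ γ : (ZMod (2 ^ (n + 1)))ˣ,
    ((thetaPt h2 u hσ₀ hε (z (γ : ZMod (2 ^ (n + 1)))) : CBall F) =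
      unitBallToCBall (E ⊔ ltField ((u : 𝒪[F]) * ((2 : ℕ) : 𝒪[F])) n : IntermediateField F (AlgebraicClosure F))
        ((mapPt (relGalOfUnit (isUniformizer_unit_mul h2 u) E n hE (v γ))
          (inclPt (le_sup_right : ltField ((u : 𝒪[F]) * ((2 : ℕ) : 𝒪[F])) n ≤
              E ⊔ ltField ((u : 𝒪[F]) * ((2 : ℕ) : 𝒪[F])) n)
            (cohPt (isUniformizer_unit_mul h2 u) n))) :
          unitBall (E ⊔ ltField ((u : 𝒪[F]) * ((2 : ℕ) : 𝒪[F])) n : IntermediateField F (AlgebraicClosure F))))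

/-- E7 ★ PROVED: k3-g40's `LocalUntwistExists` + PACKET MATCHING ⟹ VALUE IDENTIFICATION with untwisting
automorphisms acting on `𝒪_E` as `φ^{n+1}` (tree `evS_relColemanSeries` + k3-g40 `exists_untwisted_table`, `k = 0`,
+ E5). -/
theorem valueIdentification_of_packetMatching (n : ℕ) (β : RelNormCoherentUnits (isUniformizer_unit_mul h2 u) E)
    (z : ZMod (2 ^ (n + 1)) → (maxNilIdealC F).toIdeal) (v : (ZMod (2 ^ (n + 1)))ˣ → 𝒪[F]ˣ)
    (hex : LocalUntwistExists (isUniformizer_unit_mul h2 u) E hE σ₀)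
    (hP : PacketMatching h2 u E hE hσ₀ hε n z v) :
    ∃ τ : (ZMod (2 ^ (n + 1)))ˣ →
        ((E ⊔ ltField ((u : 𝒪[F]) * ((2 : ℕ) : 𝒪[F])) n : IntermediateField F (AlgebraicClosure F)) ≃ₐ[F]
          (E ⊔ ltField ((u : 𝒪[F]) * ((2 : ℕ) : 𝒪[F])) n : IntermediateField F (AlgebraicClosure F))),
      (∀ γ, ActsAsFrobPow E σ₀ (n + 1) (τ γ)) ∧ ValueIdentification hq h2 u E hE hσ₀ hε n β z τ := by
  have H := fun γ : (ZMod (2 ^ (n + 1)))ˣ =>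
    exists_untwisted_table (isUniformizer_unit_mul h2 u) E hE σ₀ hex
      (relColemanSeries (isUniformizer_unit_mul h2 u) E hq hE hσ₀ β) n 0 (β.val n)
      (evS_relColemanSeries (isUniformizer_unit_mul h2 u) E hq hE hσ₀ β n) (v γ)
  choose τ hτ hval using H
  refine ⟨τ, fun γ => by simpa using hτ γ, fun γ => ?_⟩
  rw [← hval γ]
  simp only [Function.iterate_zero, id_eq]
  exact (coe_evS_gC_eq hq h2 u E hE hσ₀ n β _ _ (hP γ)).symm

end Witness

end Summit.BirchSwinnertonDyer.BirchSwinnertonDyer.Cruxes.SplitBadTwoLowerHalfOfFacts.WeakSeamK1G43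

end
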